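import Literature.MathematicalPhysics.QuantumFieldTheory.Balaban1983to89.B9Eq360VprimeLetters

/-!
# `Balaban1983to89.B9Ineq363Vprime` — B9 p. 402 (3.63)–(3.65) FOR THE CONCRETE `V′(A)` of (3.60): the (3.63)-majorant of
# `V′(A)G′(U)` DERIVED from the concrete letters, the existence of `G′(U′U)` on the finite lattice with (3.65), Theorem 3.1's
# first inequality for it, and the bootstrap majorant of `V′(A)G′(U′U)` — all with the `V′`-side hypotheses of the cell's
# earlier B9 files ((3.54)/(3.58)/(3.61)/(3.63) «shapes») replaced by the concrete operator and (3.37)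

statement-level skeleton of published theorems with citation tags; proofs where landed; nothing here is a claim about the Yang–Mills mass gap

CITATION HEADER (lean-in-tree rule).  T. Bałaban, *Propagators for lattice gauge theories in a background field*, Commun.
Math. Phys. **99** (1985) 389–434 [Balaban1985BackgroundPropagators] (cell paper B9; `paper:balaban1985-cmp99-background-
propagators`, journal page = PDF page + 388): p. 402 [PDF 14] (render `…-p014-x2.png` read as image by this seat,
2026-08-21; PRINT: «We assume that Theorem 3.1 is valid for the operator G′(U). The equality (3.60) can be written as
Δ_{U′U} + Q′*(U′U)aQ′(U′U) = (I − V′(A)G′(U))(Δ_U + Q′*(U)aQ′(U)), (3.62) and the operator V′(A)G′(U) satisfies the bound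
|(V′(A)G′(U)λ)(x)| ≦ O(1)B₀α₁e^{−δ₀d(y,y′)} (3.63) for x ∈ Δ(y), supp λ ⊂ Δ(y′), or the bound |V′(A)G′(U)λ|_{(γ)} ≦
O(1)B₀α₁|λ|_{(γ)}. Thus for α₁ sufficiently small the norm of this operator is small and I − V′(A)G′(U) is an invertible
operator, the inverse is given by a convergent Neumann series. This implies the existence of the operator G′(U′U) and
the equality G′(U′U) = G′(U)(I − V′(A)G′(U))⁻¹ = Σ_{n=0}^∞ G′(U)(V′(A)G′(U))ⁿ. (3.64) […] What is more important we have
G′(U′U) = G′(U) + G′(U)V′(A)G′(U′U) = G′(U) + G′(U′U)V′(A)G′(U), (3.65)»), p. 403 [PDF 15, L1–9] («Now applying Theorem 3.1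
for G′(U), the bound (3.63), the representation (3.64) and Lemma 2.1 of [4] we can prove all the statements (3.42)–(3.47) of
Theorem 3.1 for the operator G′(U′U), of course with different constants, although changes are small. We define new
constants in such a way that the statements of Theorem 3.1 hold for extended operators. […] They satisfy Theorem 3.1 with
the additional small factor O(1)α₁.»; OUR GLOSS of «different constants», NOT printed: e.g. the decay rate δ₀ becomes
δ₀(1 − O(1)α₁), in this file `(1 − α′)ρ`),
p. 397 [PDF 9] (3.42), p. 400 [PDF 12] Theorem 3.4 and (3.52)–(3.53), p. 402 (3.57)–(3.61), p. 396 [PDF 8] (3.37);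
[4] = T. Bałaban, *Propagators and renormalization transformations for lattice gauge theories. II*, Commun. Math. Phys.
**96** (1984) 223–250 [Balaban1984PropagatorsII], Lemma 2.1 p. 234 ((2.61), (2.63)), (2.51)–(2.55) p. 232, (2.65)–(2.66)
p. 234.  Cell `lit-balaban`, seat r06 (B9 fold owner) gen 9, second file; SKELETON rows **B9.Eq3.62** ((3.62)–(3.65)) ×
**B9.Thm3.4** (G′-part) × B9.Eq3.60 (v1.1: + B9.Eq3.42-type entries of `G′(U′U)`, p. 403 l.1–9; v1.2, r06 gen 16, 2026-08-22,
DOC-ONLY: the quotation spans of p. 403 l.1–9 and of the sentence after (3.68) made print-verbatim — summit-lit1 g79 CITELOC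
QF79-001 — and the [4] locator (2.66) p. 235 → p. 234; no declaration, statement or proof touched).  Continuation BY NAME of this seat's `B9Eq360VprimeLetters` (gen 9: `vPrimeConc` = the
concrete `V′(A)`, `conj_vPrimeConc_eq_gradForm`, `hasMajorant_V0_vPrime`, `cBConc`), `B9Eq352GradLetters` (gen 8:
`hasMajorant_coefLetter`, `diffLetter`), of `B9Ineq386CommSum.ineq385_op_sum` (gen 8: the finite-sum composition device),
of p06/r06's `B9Eq360Vprime` §4 (`gPrimeExtEnd`, `exists_gPrimeExt_of_363`, `eq365_end`, `opNorm_lt_one_of_363_261`,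
`gpExt_entry1_of_363`), of pv10's `B9Thm34Ext` (`toB6`, `h263_of_h261`) and of pv08's `B6RandomWalk`
(`majorant_of_fixedPoint_266` = [4] (2.66)).

WHY.  The cell's kernel-checked route to Theorem 3.4's `G′`-part — (3.63) ⟹ ‖V′G′‖ < 1 ⟹ `G′(U′U) := G′(U)Σ_n(V′G′)ⁿ`
exists with (3.65) ⟹ (3.42)₁ for it ([4] (2.66)) — took the (3.63)-majorant `θe^{−δ₀d}` of `V′(A)G′(U)` as a HYPOTHESIS
(`h363` of `B9Thm34Ext.gpExt_entry1_of_365`, `B9Eq360Vprime.exists_gPrimeExt_of_363`), or derived it from (3.54)/(3.58)-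
SHAPED bounds on an abstract `V′₁` (`B9Eq360Vprime.b9_363_of_354_358`).  With `V′(A)` now a concrete operator in gradient
form with proved letter sizes (`B9Eq360VprimeLetters`), (3.63) itself becomes a theorem about the concrete perturbation:
`V′G′ = (V⁰ − avgOp)G′ + Σ_k V¹_k(∇_kG′)`, one composition of [4] (2.52)–(2.55) per word against Theorem 3.1's (3.42)₁
(`G′ ≺ B₀(Lʲη)²e^{−δd}`) and (3.42)₂ (`∇_kG′ ≺ B₀Lʲη e^{−δd}` per concrete difference letter) — and the whole (3.62)–(3.65)
paragraph follows for it with every `V′`-side input discharged down to (3.37), the transports, the stencil geometry and the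
(3.19)/(3.58)/(3.24) kernel bounds of the averaging letters.

WHAT THIS FILE PROVES (0 sorry; two bookkeeping `def`s with bodies + theorems; no `def … : Prop`).
* §1 **`ineq363_op_sum`** (abstract carrier `W`, the `G′`-side twin of (3.85)): for `V = V⁰ + Σ_{k∈s} V¹_k∇_k` with `V⁰ ≺
  c_Vα₁ℓ⁻²e^{−δd}`, `V¹_k ≺ c_kα₁ℓ⁻¹e^{−δd}` (`Σ_kc_k ≦ c_V`), `G′ ≺ B₀ℓ²e^{−δd}`, `∇_kG′ ≺ B₀ℓ e^{−δd}`, scale transfers at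
  `α`, (2.61) at `β`, (2.54): `V·G′ ≺ κ₃₈₅(B₀, c_V, 0, 0, Λ, c)·α₁·e^{−ρd}` for `ρ + (α+β)δ₀ ≦ δ` (= `B9Ineq386CommSum.ineq385_op_sum`
  at `P₁ = P₂ = 0`, BY NAME) — (3.63) in operator form with `O(1)B₀ = 2B₀Λc·c_V` explicit.
* §2 `cVConc` (= `c′_C + c_B` of `B9Eq360VprimeLetters`), `theta363` (`= κ₃₈₅(B₀, cVConc, 0, 0, Λ, c)·α₁`, the «O(1)B₀α₁»);
  **`ineq363_op_vPrime`** — (3.63) FOR THE CONCRETE `V′(A)`: `conj b V′(A) * G′ ≺ theta363·e^{−ρd}` from (3.37) blockwise,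
  the transports, the stencil geometry, the averaging kernel bounds, and (3.42)₁,₂ for `G′(U)` (per concrete difference
  letter `conj b (diffLetter η⁻¹ k)`).
* §3 **`exists_gPrimeExt_vPrime`** — «This implies the existence of the operator G′(U′U)» for the concrete `V′(A)`: under
  (2.61) at the rate `ρ` of §2 (exponent `α′ ≦ 1`) and the smallness `theta363·c₁(α′) < 1` («for α₁ sufficiently small»), an
  operator `G′(U′U)` with BOTH forms of (3.65) and, when `G′(U)` inverts `Δ′ := Δ_U + Q′*(U)aQ′(U)` two-sidedly, the
  two-sided inverse of `Δ′ − V′(A)` (3.62); **`gpExt_entry1_vPrime`** — Theorem 3.1's (3.42)₁ for `G′(U′U) :=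
  gPrimeExtEnd G′ (V′G′)`: `≺ B₀c₁(α′)(1 − theta363·c₁(α′))⁻¹·(Lʲη)²·e^{−(1−α′)ρd}` («of course with different constants, although
  changes are small»: here the rate `(1−α′)ρ` in place of δ₀ — our reading of the changed constants, not a printed formula).
* §4 **`hasMajorant_vPrime_gpExt`** — the BOOTSTRAP LETTER `V′(A)G′(U′U)` (hypothesis `hVE` of the (3.68) chain
  `B9Ineq368PPrime(Ds)`/`B9Ineq368CommSum`, there a «(3.63)-type input»): from `T := V′E = W + T·W` (`W = V′G′`, (3.65)₂)
  and [4] (2.66), `V′(A)G′(U′U) ≺ theta363·c₁(α′)(1 − theta363·c₁(α′))⁻¹·e^{−(1−α′)ρd}`.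
* §5 (v1.1) `thetaL363`; **`hasMajorant_gp_vPrime`** — the LEFT composite `G′(U)·V′(A) ≺ θ_L e^{−ρd}` for the concrete
  `V′` from its DIVERGENCE form (`B9Ineq386CommSum.hasMajorant_GV_of_gradForm_comm_sum` at `P₁ = P₂ = 0` with
  `hV0`/`hV1`/`hComm` discharged; inputs (3.42)₁ and the right-derivative entries `G′∇_k` of `G′(U)`);
  **`gpExt_rightEntry_vPrime`** — (3.42)₃ `G′(U′U)D* ≺ B₀Λ_ρ²c₁(1 − θ_Lc₁)⁻¹Lʲη e^{−(1−3α′)ρd}` from (3.65)₁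
  (`B9Eq360Vprime.eq365_end_left`) and `B9Ineq386RightEntry.gExt_rightEntry_of_386L`; **`gpExt_leftEntry_vPrime`** — every
  two-space left entry `E·G′(U′U)` ((3.42)₂,₄ type) from `E·G′(U)` via pv21's `B6RandomWalkHom.b9_leftEntry_of_365`;
  **`thm34_Gp_entries13_vPrime`** — THEOREM 3.4's `G′`-clause for the concrete `V′(A)`: the two-sided inverse of `Δ′ − V′`,
  (3.42)₁ and (3.42)₃ for one and the same `G′(U′U) = gPrimeExtEnd G′ (V′G′)`, two smallness conditions.

HONEST SCOPE / NOT CLAIMED.  (i) Theorem 3.1 for `G′(U)` enters as the two majorant hypotheses (3.42)₁ and (3.42)₂-per-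
letter (`h342_1`, `h342_2`; p. 402 «We assume that Theorem 3.1 is valid for the operator G′(U)»); the other entries
(3.42)₃,₄ and (3.43)–(3.47) for `G′(U′U)` are not treated here ((3.42)₃,₄: `B9Ineq368PPrimeDs`/`B9Ineq368CommSum` in
operator form with their own inputs; (3.43)–(3.47): located, GAPS zone G-B9-02).  (ii) As in `B9Eq360VprimeLetters`: the
averaging kernels `kQ`, `kF`, `sQ`, `sF`, `c` are parameters with the (3.19)/(3.58)/(3.24) bounds as hypotheses; finite-
dimensional `𝔸` with a real basis `b` (`M₂`, `Σ‖b_i‖`), transports of size `≦ ρu`, `d(y,y) ≦ d₀` / `d(y,y) = 0`, and (3.37)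
blockwise are bookkeeping/located readings invisible in the print's `O(1)`.  (iii) Rates: the inputs decay at `δ`, (3.63)
comes out at `ρ ≦ δ − (α+β)δ₀` and (3.42)₁ for `G′(U′U)` at `(1−α′)ρ` — the print's «δ₀(1 − O(1)α₁)» is NOT reproduced
letter for letter (the cell's Lemma-2.1 bookkeeping loses fixed fractions of the rate instead; declared, as in
`B9Thm34Ext`).  (iv) `Δ′G′(U) = 1 = G′(U)Δ′` on the finite lattice is a hypothesis of the inverse clause (Theorem 3.1 gives
`G′(U) = (Δ′)⁻¹` by definition (3.26)).  Value = the (3.62)–(3.65) paragraph kernel-checked for the concrete perturbation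
`V′(A)` of (3.60); NOT summit progress.

RELATED IN THE TREE, NOT DUPLICATED (searched 2026-08-21: `lean search 'ineq363_op|theta363|gpExt_entry1_vPrime'` = ∅;
`B9Eq360Vprime.b9_363_of_354_358` = (3.63) from (3.54)/(3.58) SHAPES for an abstract `V′₁` in the scalar block model — a
different input form; `B9Thm34Ext.gpExt_entry1_of_365`/`B9Eq360Vprime.gpExt_entry1_of_363`/`exists_gPrimeExt_of_363` are
USED here with `h363` discharged; `B9Ineq385VG.ineq385_op`/`B9Ineq386CommSum.ineq385_op_sum` are the `G`-side (3.85)).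
-/

noncomputable section

namespace Literature.MathematicalPhysics.QuantumFieldTheory.Balaban1983to89.B9Ineq363Vprime

open Literature.MathematicalPhysics.QuantumFieldTheory.Balaban1983to89
open Literature.MathematicalPhysics.QuantumFieldTheory.Balaban1983to89.B6RandomWalk (HasMajorant hasMajorant_mono
  hasMajorant_add hasMajorant_zero Triangle254 Ineq261 majorant_of_fixedPoint_266)
open Literature.MathematicalPhysics.QuantumFieldTheory.Balaban1983to89.B9Thm34Ext (toB6 h263_of_h261)
open Literature.MathematicalPhysics.QuantumFieldTheory.Balaban1983to89.B9Ineq347 (ScaleTransfer)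
open Literature.MathematicalPhysics.QuantumFieldTheory.Balaban1983to89.B9Eq39Adjoint (covD covDstar)
open Literature.MathematicalPhysics.QuantumFieldTheory.Balaban1983to89.B9Eq386Neumann (vTotal)
open Literature.MathematicalPhysics.QuantumFieldTheory.Balaban1983to89.B9Ineq385VG (kappa385 kappa385_nonneg)
open Literature.MathematicalPhysics.QuantumFieldTheory.Balaban1983to89.B9Ineq386CommSum (ineq385_op_sum)
open Literature.MathematicalPhysics.QuantumFieldTheory.Balaban1983to89.B9Eq360Vprime (gPrimeExtEnd
  exists_gPrimeExt_of_363 eq365_end opNorm_lt_one_of_363_261 gpExt_entry1_of_363)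
open Literature.MathematicalPhysics.QuantumFieldTheory.Balaban1983to89.B9Eq352DivForm (tauB)
open Literature.MathematicalPhysics.QuantumFieldTheory.Balaban1983to89.B9Eq352DivFormLetters (conj)
open Literature.MathematicalPhysics.QuantumFieldTheory.Balaban1983to89.B9Eq352GradLetters (V0op coefLetter diffLetter
  hasMajorant_coefLetter)
open Literature.MathematicalPhysics.QuantumFieldTheory.Balaban1983to89.B9Eq360VprimeLetters (avgOp vPrimeConc
  conj_vPrimeConc_eq_gradForm hasMajorant_V0_vPrime cBConc)

/-! ## §1  (3.63) in operator form for a finite-sum gradient form `V = V⁰ + Σ_k V¹_k∇_k` (abstract carrier) -/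

section Abstract

variable {g : B9.Geometry} [Fintype g.Site] {R : ℝ} {H : Prop} {W : Type} {K : Type}

/-- **(3.63) in the block-majorant form of [4] (2.51), for a first-order operator in finite-sum gradient form** —
«the operator V′(A)G′(U) satisfies the bound |(V′(A)G′(U)λ)(x)| ≦ O(1)B₀α₁e^{−δ₀d(y,y′)} for x ∈ Δ(y), supp λ ⊂ Δ(y′)»:
with `V = V⁰ + Σ_{k∈s} V¹_k∇_k`, `V⁰ ≺ c_Vα₁(Lʲη)⁻²e^{−δd}`, `V¹_k ≺ c_kα₁(Lʲη)⁻¹e^{−δd}` (`Σ_kc_k ≦ c_V`; the (3.61) sizes),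
Theorem 3.1 for `G′(U)` in the form (3.42)₁ `G′ ≺ B₀(Lʲη)²e^{−δd}` and (3.42)₂ `∇_kG′ ≺ B₀Lʲη e^{−δd}` per difference letter,
the scale transfers of `Lʲη`, `(Lʲη)²` at exponent `α` (constant `Λ ≧ 0`), (2.61) at `β` and (2.54):
`V·G′ ≺ κ₃₈₅(B₀, c_V, 0, 0, Λ, c₁(β))·α₁·e^{−ρd(y,y′)}` for `ρ ≧ 0`, `ρ + (α+β)δ₀ ≦ δ` — `O(1)B₀ = 2B₀Λc₁(β)c_V` EXPLICIT.
(`B9Ineq386CommSum.ineq385_op_sum` with `P₁ = P₂ = 0`, BY NAME.)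
[cite: Balaban1985BackgroundPropagators, (3.61)–(3.63) p.402 + (3.42) p.397; Balaban1984PropagatorsII, Lemma 2.1 p.234 + (2.52)–(2.55) p.232] -/
theorem ineq363_op_sum (blk : W → g.Site) (d : ℕ) (s : Finset K) (δ₀ δ α β ρ Λ B₀ cV α₁ : ℝ) (c1 : K → ℝ)
    (hB₀ : 0 ≤ B₀) (hcV : 0 ≤ cV) (hα₁ : 0 ≤ α₁) (hΛ : 0 ≤ Λ) (hρ : 0 ≤ ρ) (hα : 0 ≤ α) (hβ : 0 ≤ β) (hδ₀ : 0 ≤ δ₀)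
    (hr : ρ + (α + β) * δ₀ ≤ δ) (hc1 : ∀ k ∈ s, 0 ≤ c1 k) (hsum : ∑ k ∈ s, c1 k ≤ cV)
    (hdnn : ∀ a b : g.Site, 0 ≤ g.dist a b) (htri : Triangle254 (toB6 g R H)) (hlen : ∀ y : g.Site, 0 < g.len y)
    (h261 : Ineq261 d (toB6 g R H) δ₀ β)
    (hT1 : ScaleTransfer g δ₀ α Λ (fun a => g.len a)) (hT2 : ScaleTransfer g δ₀ α Λ (fun a => g.len a ^ 2))
    {G V V0 : Module.End ℝ (W → ℝ)} {V1 D : K → Module.End ℝ (W → ℝ)} (hVg : V = V0 + ∑ k ∈ s, V1 k * D k)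
    (hV0 : HasMajorant (g := toB6 g R H) blk V0
      (fun a b => cV * α₁ * (g.len a ^ 2)⁻¹ * Real.exp (-(δ * g.dist a b))))
    (hV1 : ∀ k ∈ s, HasMajorant (g := toB6 g R H) blk (V1 k)
      (fun a b => c1 k * α₁ * (g.len a)⁻¹ * Real.exp (-(δ * g.dist a b))))
    (hG : HasMajorant (g := toB6 g R H) blk G (fun a b => B₀ * g.len a ^ 2 * Real.exp (-(δ * g.dist a b))))
    (hDG : ∀ k ∈ s, HasMajorant (g := toB6 g R H) blk (D k * G)
      (fun a b => B₀ * g.len a * Real.exp (-(δ * g.dist a b)))) :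
    HasMajorant (g := toB6 g R H) blk (V * G)
      (fun a b => kappa385 B₀ cV 0 0 Λ (B6.c1 d δ₀ β) * α₁ * Real.exp (-(ρ * g.dist a b))) := by
  have hP : HasMajorant (g := toB6 g R H) blk (0 : Module.End ℝ (W → ℝ))
      (fun a b => 0 * α₁ * (g.len a ^ 2)⁻¹ * Real.exp (-(δ * g.dist a b))) :=
    hasMajorant_mono (g := toB6 g R H) blk (hasMajorant_zero (g := toB6 g R H) blk) fun a b => le_of_eq (by ring)
  have h := ineq385_op_sum (R := R) (H := H) blk d s δ₀ δ α β ρ Λ B₀ cV 0 0 α₁ c1 hB₀ hcV le_rfl le_rfl hα₁ hΛ hρ hα hβ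
    hδ₀ hr hc1 hsum hdnn htri hlen h261 hT1 hT2 (P₁ := 0) (P₂ := 0) hVg hV0 hV1 hP hP hG hDG
  have e : vTotal V (0 : Module.End ℝ (W → ℝ)) 0 * G = V * G := by simp [vTotal]
  rw [e] at h
  exact h

end Abstract

/-! ## §2  (3.63) for the CONCRETE `V′(A)` of (3.60) -/

section Concrete

variable {𝔸 : Type*} [NormedRing 𝔸] [NormedAlgebra ℂ 𝔸] [CompleteSpace 𝔸] {ι : Type} [Fintype ι]
variable (b : Module.Basis ι ℝ 𝔸) {S : Type} [Fintype S] {κ : Type} [Fintype κ]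
variable (T : κ → Equiv.Perm S) (U : κ → S → 𝔸ˣ)
variable {g : B9.Geometry} [Fintype g.Site] [DecidableEq g.Site] {Rr : ℝ} {H : Prop}

/-- The `c_V` of the concrete `V′(A)` after coordinates: the zeroth-order constant `c′_C = ((2 + 8ρu²α₁)d + a₀C(2 + Cα₁))·
M₂(Σ‖b‖)e^{δd₀}` of `B9Eq360VprimeLetters.hasMajorant_V0_vPrime` plus the summed coefficient constant `c_B = 2d·2M₂(Σ‖b‖)e^{δd₀}`
(`B9Eq360VprimeLetters.cBConc`). [cite: Balaban1985BackgroundPropagators, (3.61) p.402 + (3.73) p.405] -/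
def cVConc (d : ℕ) (ρu α₁ a₀ C M₂ Sb E₀ : ℝ) : ℝ :=
  ((2 + 8 * ρu ^ 2 * α₁) * d + a₀ * C * (2 + C * α₁)) * M₂ * Sb * E₀ + cBConc d M₂ Sb E₀

/-- The «O(1)B₀α₁» of (3.63) produced for the concrete `V′(A)`: `θ₃₆₃ = κ₃₈₅(B₀, cVConc, 0, 0, Λ, c)·α₁ = 2B₀Λc·cVConc·α₁`.
[cite: Balaban1985BackgroundPropagators, (3.63) p.402] -/
def theta363 (d : ℕ) (ρu α₁ a₀ C M₂ Sb E₀ B₀ Λ c : ℝ) : ℝ :=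
  kappa385 B₀ (cVConc d ρu α₁ a₀ C M₂ Sb E₀) 0 0 Λ c * α₁

/-- `cVConc ≧ 0`. [cite: Balaban1985BackgroundPropagators, (3.61) p.402] -/
theorem cVConc_nonneg {d : ℕ} {ρu α₁ a₀ C M₂ Sb E₀ : ℝ} (hα₁ : 0 ≤ α₁) (ha₀ : 0 ≤ a₀) (hC : 0 ≤ C) (hM₂ : 0 ≤ M₂)
    (hSb : 0 ≤ Sb) (hE₀ : 0 ≤ E₀) : 0 ≤ cVConc d ρu α₁ a₀ C M₂ Sb E₀ := by
  unfold cVConc cBConc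
  positivity

/-- `θ₃₆₃ ≧ 0`. [cite: Balaban1985BackgroundPropagators, (3.63) p.402] -/
theorem theta363_nonneg {d : ℕ} {ρu α₁ a₀ C M₂ Sb E₀ B₀ Λ c : ℝ} (hα₁ : 0 ≤ α₁) (ha₀ : 0 ≤ a₀) (hC : 0 ≤ C)
    (hM₂ : 0 ≤ M₂) (hSb : 0 ≤ Sb) (hE₀ : 0 ≤ E₀) (hB₀ : 0 ≤ B₀) (hΛ : 0 ≤ Λ) (hc : 0 ≤ c) :
    0 ≤ theta363 d ρu α₁ a₀ C M₂ Sb E₀ B₀ Λ c :=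
  mul_nonneg (kappa385_nonneg hB₀ (cVConc_nonneg hα₁ ha₀ hC hM₂ hSb hE₀) le_rfl le_rfl hΛ hc) hα₁

/-- **(3.63) FOR THE CONCRETE `V′(A)` OF (3.60)** — «the operator V′(A)G′(U) satisfies the bound |(V′(A)G′(U)λ)(x)| ≦
O(1)B₀α₁e^{−δ₀d(y,y′)} (3.63) for x ∈ Δ(y), supp λ ⊂ Δ(y′)», here with `V′(A) = vPrimeConc T U η A …` after real
coordinates and `O(1)B₀α₁ = θ₃₆₃` EXPLICIT.  INPUTS: (3.37) read blockwise for the letters of `V′₁(A)` as they occur, the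
transports `‖U‖, ‖U⁻¹‖ ≦ ρu`, `ηα₁ℓ⁻¹ ≦ 1/4`, the stencil geometry (`d`-distance `≦ d₀` inside the star, `d(y,y) ≦ d₀`), the
(3.19)/(3.58)/(3.24) kernel bounds of the averaging letters, the coordinate bound `M₂`; «We assume that Theorem 3.1 is
valid for the operator G′(U)»: (3.42)₁ `G′ ≺ B₀(Lʲη)²e^{−δd}` and (3.42)₂ `∇_kG′ ≺ B₀Lʲη e^{−δd}` for each concrete
difference letter `∇_k = conj b (diffLetter η⁻¹ k)`; Lemma 2.1 of [4] (scale transfers at `α`, (2.61) at `β`, (2.54)).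
[cite: Balaban1985BackgroundPropagators, (3.63) p.402 + (3.60)–(3.61) p.402 + (3.52) p.400 + (3.37) p.396 + (3.42) p.397; Balaban1984PropagatorsII, Lemma 2.1 p.234 + (2.51)–(2.55) p.232] -/
theorem ineq363_op_vPrime (blk : S → g.Site) (d : ℕ) {η : ℝ} (hη : 0 < η) (A : κ → S → 𝔸)
    (kQ kF : g.Site → S → 𝔸 →L[ℝ] 𝔸) (sQ sF : S → 𝔸 →L[ℝ] 𝔸) (c w : g.Site → ℝ) (ρu d₀ M₂ C a₀ : ℝ)
    (δ₀ δ α β ρ Λ B₀ α₁ : ℝ)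
    (hB₀ : 0 ≤ B₀) (hα₁ : 0 ≤ α₁) (hΛ : 0 ≤ Λ) (hρ : 0 ≤ ρ) (hα : 0 ≤ α) (hβ : 0 ≤ β) (hδ₀ : 0 ≤ δ₀) (hδ : 0 ≤ δ)
    (hr : ρ + (α + β) * δ₀ ≤ δ)
    (hdnn : ∀ a a' : g.Site, 0 ≤ g.dist a a') (htri : Triangle254 (toB6 g Rr H)) (hlen : ∀ y : g.Site, 0 < g.len y)
    (h261 : Ineq261 d (toB6 g Rr H) δ₀ β)
    (hT1 : ScaleTransfer g δ₀ α Λ (fun a => g.len a)) (hT2 : ScaleTransfer g δ₀ α Λ (fun a => g.len a ^ 2))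
    (hM₂ : 0 ≤ M₂) (hrepr : ∀ (v : 𝔸) (i : ι), |b.repr v i| ≤ M₂ * ‖v‖)
    (hsmall : ∀ y : g.Site, η * (α₁ * (g.len y)⁻¹) ≤ 1 / 4)
    (hA : ∀ μ x, ‖A μ x‖ ≤ α₁ * (g.len (blk x))⁻¹ ∧ ‖tauB T U μ (A μ) x‖ ≤ α₁ * (g.len (blk x))⁻¹)
    (h337s : ∀ μ x, ‖((η : ℂ)⁻¹) • covDstar T U μ (A μ) x‖ ≤ α₁ * (g.len (blk x) ^ 2)⁻¹)
    (hρu : ∀ μ x, ‖((U μ x : 𝔸ˣ) : 𝔸)‖ ≤ ρu ∧ ‖(((U μ x)⁻¹ : 𝔸ˣ) : 𝔸)‖ ≤ ρu)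
    (hd₀ : ∀ μ x, g.dist (blk x) (blk (T μ x)) ≤ d₀ ∧ g.dist (blk x) (blk ((T μ).symm x)) ≤ d₀)
    (hd₀0 : ∀ y : g.Site, g.dist y y ≤ d₀)
    (hw : ∀ y, 0 ≤ w y) (hcard : ∀ y, ((B9Eq360Vprime.block blk y).card : ℝ) * w y ≤ 1) (hC : 0 ≤ C) (ha₀ : 0 ≤ a₀)
    (hkQ : ∀ y x, blk x = y → ‖kQ y x‖ ≤ w y) (hkF : ∀ y x, blk x = y → ‖kF y x‖ ≤ C * α₁ * w y)
    (hsQ : ∀ x, ‖sQ x‖ ≤ 1) (hsF : ∀ x, ‖sF x‖ ≤ C * α₁) (hc : ∀ y, |c y| ≤ a₀ * (g.len y ^ 2)⁻¹)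
    {Gp : Module.End ℝ (S × ι → ℝ)}
    (h342_1 : HasMajorant (g := toB6 g Rr H) (fun p : S × ι => blk p.1) Gp
      (fun a a' => B₀ * g.len a ^ 2 * Real.exp (-(δ * g.dist a a'))))
    (h342_2 : ∀ k : κ ⊕ κ, HasMajorant (g := toB6 g Rr H) (fun p : S × ι => blk p.1)
      (conj b (diffLetter T U ((η : ℂ)⁻¹) k) * Gp) (fun a a' => B₀ * g.len a * Real.exp (-(δ * g.dist a a')))) :
    HasMajorant (g := toB6 g Rr H) (fun p : S × ι => blk p.1)
      (conj b (vPrimeConc T U η A blk kQ kF sQ sF c) * Gp)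
      (fun a a' => theta363 (Fintype.card κ) ρu α₁ a₀ C M₂ (∑ i, ‖b i‖) (Real.exp (δ * d₀)) B₀ Λ (B6.c1 d δ₀ β) *
        Real.exp (-(ρ * g.dist a a'))) := by
  have hSb : 0 ≤ ∑ i, ‖b i‖ := Finset.sum_nonneg fun i _ => norm_nonneg _
  have hE₀ : 0 ≤ Real.exp (δ * d₀) := Real.exp_nonneg _
  have hcB : 0 ≤ cBConc (Fintype.card κ) M₂ (∑ i, ‖b i‖) (Real.exp (δ * d₀)) := by
    unfold cBConc; positivity
  have hcC0 : 0 ≤ ((2 + 8 * ρu ^ 2 * α₁) * Fintype.card κ + a₀ * C * (2 + C * α₁)) * M₂ * (∑ i, ‖b i‖) *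
      Real.exp (δ * d₀) := by positivity
  have hcV : 0 ≤ cVConc (Fintype.card κ) ρu α₁ a₀ C M₂ (∑ i, ‖b i‖) (Real.exp (δ * d₀)) :=
    cVConc_nonneg hα₁ ha₀ hC hM₂ hSb hE₀
  -- `hV0` at the larger constant `cVConc`
  have hV0 : HasMajorant (g := toB6 g Rr H) (fun p : S × ι => blk p.1)
      (conj b (V0op T U η A) - conj b (avgOp blk kQ kF sQ sF c))
      (fun y y' => cVConc (Fintype.card κ) ρu α₁ a₀ C M₂ (∑ i, ‖b i‖) (Real.exp (δ * d₀)) * α₁ * (g.len y ^ 2)⁻¹ *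
        Real.exp (-(δ * g.dist y y'))) := by
    refine hasMajorant_mono (g := toB6 g Rr H) _
      (hasMajorant_V0_vPrime b T U blk hη A kQ kF sQ sF c w ρu d₀ δ M₂ α₁ C a₀ hα₁ hδ hM₂ hrepr hlen hsmall hA h337s hρu
        hd₀ hd₀0 hw hcard hC ha₀ hkQ hkF hsQ hsF hc) fun y y' => ?_
    have hw2 : 0 ≤ (g.len y ^ 2)⁻¹ := inv_nonneg.mpr (sq_nonneg _)
    have hε : 0 ≤ Real.exp (-(δ * g.dist y y')) := Real.exp_nonneg _
    have hle : ((2 + 8 * ρu ^ 2 * α₁) * Fintype.card κ + a₀ * C * (2 + C * α₁)) * M₂ * (∑ i, ‖b i‖) *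
        Real.exp (δ * d₀) ≤ cVConc (Fintype.card κ) ρu α₁ a₀ C M₂ (∑ i, ‖b i‖) (Real.exp (δ * d₀)) := by
      unfold cVConc; linarith
    gcongr
  have h := ineq363_op_sum (R := Rr) (H := H) (fun p : S × ι => blk p.1) d (Finset.univ : Finset (κ ⊕ κ)) δ₀ δ α β ρ Λ
    B₀ (cVConc (Fintype.card κ) ρu α₁ a₀ C M₂ (∑ i, ‖b i‖) (Real.exp (δ * d₀))) α₁
    (fun _ => 2 * M₂ * (∑ i, ‖b i‖) * Real.exp (δ * d₀)) hB₀ hcV hα₁ hΛ hρ hα hβ hδ₀ hr (fun _ _ => by positivity) ?_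
    hdnn htri hlen h261 hT1 hT2 (V1 := fun k => conj b (coefLetter T U A k))
    (D := fun k => conj b (diffLetter T U ((η : ℂ)⁻¹) k)) (conj_vPrimeConc_eq_gradForm b T U η A blk kQ kF sQ sF c)
    hV0 (fun k _ => hasMajorant_coefLetter b T U blk A d₀ δ M₂ α₁ hα₁ hδ hM₂ hrepr hlen hA hd₀0 k) h342_1
    (fun k _ => h342_2 k)
  · simpa only [theta363, mul_assoc] using h
  · rw [Finset.sum_const, Finset.card_univ, Fintype.card_sum, nsmul_eq_mul, Nat.cast_add, cVConc, cBConc]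
    nlinarith [hcC0]

end Concrete

/-! ## §3  «This implies the existence of the operator G′(U′U)» and Theorem 3.1's (3.42)₁ for it, for the concrete `V′(A)` -/

section Existence

variable {𝔸 : Type*} [NormedRing 𝔸] [NormedAlgebra ℂ 𝔸] [CompleteSpace 𝔸] {ι : Type} [Fintype ι]
variable (b : Module.Basis ι ℝ 𝔸) {S : Type} [Fintype S] {κ : Type} [Fintype κ]
variable (T : κ → Equiv.Perm S) (U : κ → S → 𝔸ˣ)
variable {g : B9.Geometry} [Fintype g.Site] [DecidableEq g.Site] {Rr : ℝ} {H : Prop}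

/-- **EXISTENCE OF `G′(U′U)` FOR THE CONCRETE `V′(A)`** — «Thus for α₁ sufficiently small the norm of this operator is
small and I − V′(A)G′(U) is an invertible operator, the inverse is given by a convergent Neumann series. This implies the
existence of the operator G′(U′U) and the equality (3.64) […] (3.65)»: given the (3.63)-majorant `θe^{−ρd}` of
`V′(A)G′(U)` for the concrete `V′` (§2, `θ = θ₃₆₃`), (2.61) of [4] at the rate `ρ` with exponent `α′` and the smallness
`θc₁(α′) < 1`, there is an operator `G′(U′U)` on the finite lattice with BOTH forms of (3.65) and — when `G′(U)` is the
two-sided inverse of `Δ′ = Δ_U + Q′*(U)aQ′(U)` — the two-sided inverse property for `Δ′ − V′(A)` ((3.60)/(3.62)).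
(`B9Eq360Vprime.exists_gPrimeExt_of_363` with `h363 := ineq363_op_vPrime`.)
[cite: Balaban1985BackgroundPropagators, (3.62)–(3.65) p.402 + Thm 3.4 p.400; Balaban1984PropagatorsII, Lemma 2.1 p.234] -/
theorem exists_gPrimeExt_vPrime (blk : S → g.Site) (d : ℕ) {η : ℝ} (hη : 0 < η) (A : κ → S → 𝔸)
    (kQ kF : g.Site → S → 𝔸 →L[ℝ] 𝔸) (sQ sF : S → 𝔸 →L[ℝ] 𝔸) (c w : g.Site → ℝ) (ρu d₀ M₂ C a₀ : ℝ)
    (δ₀ δ α β ρ Λ B₀ α₁ α' : ℝ)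
    (hB₀ : 0 ≤ B₀) (hα₁ : 0 ≤ α₁) (hΛ : 0 ≤ Λ) (hρ : 0 ≤ ρ) (hα : 0 ≤ α) (hβ : 0 ≤ β) (hδ₀ : 0 ≤ δ₀) (hδ : 0 ≤ δ)
    (hr : ρ + (α + β) * δ₀ ≤ δ) (hα'ρ : 0 ≤ (1 - α') * ρ)
    (hdnn : ∀ a a' : g.Site, 0 ≤ g.dist a a') (htri : Triangle254 (toB6 g Rr H)) (hlen : ∀ y : g.Site, 0 < g.len y)
    (h261 : Ineq261 d (toB6 g Rr H) δ₀ β) (h261' : Ineq261 d (toB6 g Rr H) ρ α')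
    (hT1 : ScaleTransfer g δ₀ α Λ (fun a => g.len a)) (hT2 : ScaleTransfer g δ₀ α Λ (fun a => g.len a ^ 2))
    (hM₂ : 0 ≤ M₂) (hrepr : ∀ (v : 𝔸) (i : ι), |b.repr v i| ≤ M₂ * ‖v‖)
    (hsmall : ∀ y : g.Site, η * (α₁ * (g.len y)⁻¹) ≤ 1 / 4)
    (hA : ∀ μ x, ‖A μ x‖ ≤ α₁ * (g.len (blk x))⁻¹ ∧ ‖tauB T U μ (A μ) x‖ ≤ α₁ * (g.len (blk x))⁻¹)
    (h337s : ∀ μ x, ‖((η : ℂ)⁻¹) • covDstar T U μ (A μ) x‖ ≤ α₁ * (g.len (blk x) ^ 2)⁻¹)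
    (hρu : ∀ μ x, ‖((U μ x : 𝔸ˣ) : 𝔸)‖ ≤ ρu ∧ ‖(((U μ x)⁻¹ : 𝔸ˣ) : 𝔸)‖ ≤ ρu)
    (hd₀ : ∀ μ x, g.dist (blk x) (blk (T μ x)) ≤ d₀ ∧ g.dist (blk x) (blk ((T μ).symm x)) ≤ d₀)
    (hd₀0 : ∀ y : g.Site, g.dist y y ≤ d₀)
    (hw : ∀ y, 0 ≤ w y) (hcard : ∀ y, ((B9Eq360Vprime.block blk y).card : ℝ) * w y ≤ 1) (hC : 0 ≤ C) (ha₀ : 0 ≤ a₀)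
    (hkQ : ∀ y x, blk x = y → ‖kQ y x‖ ≤ w y) (hkF : ∀ y x, blk x = y → ‖kF y x‖ ≤ C * α₁ * w y)
    (hsQ : ∀ x, ‖sQ x‖ ≤ 1) (hsF : ∀ x, ‖sF x‖ ≤ C * α₁) (hc : ∀ y, |c y| ≤ a₀ * (g.len y ^ 2)⁻¹)
    (hθ : theta363 (Fintype.card κ) ρu α₁ a₀ C M₂ (∑ i, ‖b i‖) (Real.exp (δ * d₀)) B₀ Λ (B6.c1 d δ₀ β) *
      B6.c1 d ρ α' < 1)
    (Δp Gp : Module.End ℝ (S × ι → ℝ)) (hΔG : Δp * Gp = 1) (hGΔ : Gp * Δp = 1)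
    (h342_1 : HasMajorant (g := toB6 g Rr H) (fun p : S × ι => blk p.1) Gp
      (fun a a' => B₀ * g.len a ^ 2 * Real.exp (-(δ * g.dist a a'))))
    (h342_2 : ∀ k : κ ⊕ κ, HasMajorant (g := toB6 g Rr H) (fun p : S × ι => blk p.1)
      (conj b (diffLetter T U ((η : ℂ)⁻¹) k) * Gp) (fun a a' => B₀ * g.len a * Real.exp (-(δ * g.dist a a')))) :
    ∃ GpExt : Module.End ℝ (S × ι → ℝ),
      GpExt = Gp + Gp * conj b (vPrimeConc T U η A blk kQ kF sQ sF c) * GpExt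
        ∧ GpExt = Gp + GpExt * (conj b (vPrimeConc T U η A blk kQ kF sQ sF c) * Gp)
        ∧ (Δp - conj b (vPrimeConc T U η A blk kQ kF sQ sF c)) * GpExt = 1
        ∧ GpExt * (Δp - conj b (vPrimeConc T U η A blk kQ kF sQ sF c)) = 1 := by
  have hSb : 0 ≤ ∑ i, ‖b i‖ := Finset.sum_nonneg fun i _ => norm_nonneg _
  have hθ0 : 0 ≤ theta363 (Fintype.card κ) ρu α₁ a₀ C M₂ (∑ i, ‖b i‖) (Real.exp (δ * d₀)) B₀ Λ (B6.c1 d δ₀ β) :=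
    theta363_nonneg hα₁ ha₀ hC hM₂ hSb (Real.exp_nonneg _) hB₀ hΛ (B6RandomWalk.c1_nonneg d δ₀ β)
  exact exists_gPrimeExt_of_363 (g := toB6 g Rr H) (fun p : S × ι => blk p.1) d ρ α' _ hθ0 hα'ρ hdnn h261' hθ Δp Gp
    (conj b (vPrimeConc T U η A blk kQ kF sQ sF c)) hΔG hGΔ
    (ineq363_op_vPrime b T U blk d hη A kQ kF sQ sF c w ρu d₀ M₂ C a₀ δ₀ δ α β ρ Λ B₀ α₁ hB₀ hα₁ hΛ hρ hα hβ hδ₀ hδ hr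
      hdnn htri hlen h261 hT1 hT2 hM₂ hrepr hsmall hA h337s hρu hd₀ hd₀0 hw hcard hC ha₀ hkQ hkF hsQ hsF hc h342_1 h342_2)

variable [DecidableEq ι] [DecidableEq S]

/-- **THEOREM 3.1's FIRST INEQUALITY FOR `G′(U′U)`, CONCRETE `V′(A)`** — p. 403 «Now applying Theorem 3.1 for G′(U), the bound
(3.63), the representation (3.64) and Lemma 2.1 of [4] we can prove all the statements (3.42)–(3.47) of Theorem 3.1 for
the operator G′(U′U), of course with different constants, although changes are small», first statement: the operator `G′(U′U) := G′(U)Σ_n(V′G′)ⁿ`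
of (3.64) on the finite lattice (`B9Eq360Vprime.gPrimeExtEnd`; it satisfies (3.65) by `B9Eq360Vprime.eq365_end`) obeys
`G′(U′U) ≺ B₀c₁(α′)(1 − θ₃₆₃c₁(α′))⁻¹·(Lʲη)²·e^{−(1−α′)ρd(y,y′)}` — with the (3.63)-input a THEOREM for the concrete `V′(A)`
(§2).  Extra inputs: (2.61) at `(ρ, α′)` with `α′ ≦ 1`, `0 ≦ (1−α′)ρ`, `d(y,y) = 0`, the smallness `θ₃₆₃c₁(α′) < 1` («for α₁
sufficiently small»). [cite: Balaban1985BackgroundPropagators, Thm 3.4 p.400 + (3.62)–(3.65) pp.402–403 + (3.42) p.397; Balaban1984PropagatorsII, Lemma 2.1 p.234 + (2.66) p.234] -/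
theorem gpExt_entry1_vPrime (blk : S → g.Site) (d : ℕ) {η : ℝ} (hη : 0 < η) (A : κ → S → 𝔸)
    (kQ kF : g.Site → S → 𝔸 →L[ℝ] 𝔸) (sQ sF : S → 𝔸 →L[ℝ] 𝔸) (c w : g.Site → ℝ) (ρu d₀ M₂ C a₀ : ℝ)
    (δ₀ δ α β ρ Λ B₀ α₁ α' : ℝ)
    (hB₀ : 0 ≤ B₀) (hα₁ : 0 ≤ α₁) (hΛ : 0 ≤ Λ) (hρ : 0 ≤ ρ) (hα : 0 ≤ α) (hβ : 0 ≤ β) (hδ₀ : 0 ≤ δ₀) (hδ : 0 ≤ δ)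
    (hr : ρ + (α + β) * δ₀ ≤ δ) (hα'ρ : 0 ≤ (1 - α') * ρ) (hα'1 : α' ≤ 1)
    (hdnn : ∀ a a' : g.Site, 0 ≤ g.dist a a') (hrefl : ∀ y : g.Site, g.dist y y = 0)
    (htri : Triangle254 (toB6 g Rr H)) (hlen : ∀ y : g.Site, 0 < g.len y)
    (h261 : Ineq261 d (toB6 g Rr H) δ₀ β) (h261' : Ineq261 d (toB6 g Rr H) ρ α')
    (hT1 : ScaleTransfer g δ₀ α Λ (fun a => g.len a)) (hT2 : ScaleTransfer g δ₀ α Λ (fun a => g.len a ^ 2))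
    (hM₂ : 0 ≤ M₂) (hrepr : ∀ (v : 𝔸) (i : ι), |b.repr v i| ≤ M₂ * ‖v‖)
    (hsmall : ∀ y : g.Site, η * (α₁ * (g.len y)⁻¹) ≤ 1 / 4)
    (hA : ∀ μ x, ‖A μ x‖ ≤ α₁ * (g.len (blk x))⁻¹ ∧ ‖tauB T U μ (A μ) x‖ ≤ α₁ * (g.len (blk x))⁻¹)
    (h337s : ∀ μ x, ‖((η : ℂ)⁻¹) • covDstar T U μ (A μ) x‖ ≤ α₁ * (g.len (blk x) ^ 2)⁻¹)
    (hρu : ∀ μ x, ‖((U μ x : 𝔸ˣ) : 𝔸)‖ ≤ ρu ∧ ‖(((U μ x)⁻¹ : 𝔸ˣ) : 𝔸)‖ ≤ ρu)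
    (hd₀ : ∀ μ x, g.dist (blk x) (blk (T μ x)) ≤ d₀ ∧ g.dist (blk x) (blk ((T μ).symm x)) ≤ d₀)
    (hd₀0 : ∀ y : g.Site, g.dist y y ≤ d₀)
    (hw : ∀ y, 0 ≤ w y) (hcard : ∀ y, ((B9Eq360Vprime.block blk y).card : ℝ) * w y ≤ 1) (hC : 0 ≤ C) (ha₀ : 0 ≤ a₀)
    (hkQ : ∀ y x, blk x = y → ‖kQ y x‖ ≤ w y) (hkF : ∀ y x, blk x = y → ‖kF y x‖ ≤ C * α₁ * w y)
    (hsQ : ∀ x, ‖sQ x‖ ≤ 1) (hsF : ∀ x, ‖sF x‖ ≤ C * α₁) (hc : ∀ y, |c y| ≤ a₀ * (g.len y ^ 2)⁻¹)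
    (hθ : theta363 (Fintype.card κ) ρu α₁ a₀ C M₂ (∑ i, ‖b i‖) (Real.exp (δ * d₀)) B₀ Λ (B6.c1 d δ₀ β) *
      B6.c1 d ρ α' < 1)
    {Gp : Module.End ℝ (S × ι → ℝ)}
    (h342_1 : HasMajorant (g := toB6 g Rr H) (fun p : S × ι => blk p.1) Gp
      (fun a a' => B₀ * g.len a ^ 2 * Real.exp (-(δ * g.dist a a'))))
    (h342_2 : ∀ k : κ ⊕ κ, HasMajorant (g := toB6 g Rr H) (fun p : S × ι => blk p.1)
      (conj b (diffLetter T U ((η : ℂ)⁻¹) k) * Gp) (fun a a' => B₀ * g.len a * Real.exp (-(δ * g.dist a a')))) :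
    HasMajorant (g := toB6 g Rr H) (fun p : S × ι => blk p.1)
      (gPrimeExtEnd Gp (conj b (vPrimeConc T U η A blk kQ kF sQ sF c) * Gp))
      (fun a a' => B₀ * B6.c1 d ρ α'
          * (1 - theta363 (Fintype.card κ) ρu α₁ a₀ C M₂ (∑ i, ‖b i‖) (Real.exp (δ * d₀)) B₀ Λ (B6.c1 d δ₀ β)
              * B6.c1 d ρ α')⁻¹
          * g.len a ^ 2 * Real.exp (-((1 - α') * ρ * g.dist a a'))) := by
  have hSb : 0 ≤ ∑ i, ‖b i‖ := Finset.sum_nonneg fun i _ => norm_nonneg _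
  have hθ0 : 0 ≤ theta363 (Fintype.card κ) ρu α₁ a₀ C M₂ (∑ i, ‖b i‖) (Real.exp (δ * d₀)) B₀ Λ (B6.c1 d δ₀ β) :=
    theta363_nonneg hα₁ ha₀ hC hM₂ hSb (Real.exp_nonneg _) hB₀ hΛ (B6RandomWalk.c1_nonneg d δ₀ β)
  have hρδ : ρ ≤ δ := by
    have : 0 ≤ (α + β) * δ₀ := by positivity
    linarith
  -- (3.42)₁ for `G′(U)` at the weaker rate `ρ`
  have hGρ : HasMajorant (g := toB6 g Rr H) (fun p : S × ι => blk p.1) Gp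
      (fun a a' => B₀ * g.len a ^ 2 * Real.exp (-(ρ * g.dist a a'))) :=
    hasMajorant_mono (g := toB6 g Rr H) _ h342_1 fun a a' =>
      mul_le_mul_of_nonneg_left (Real.exp_le_exp.mpr (by nlinarith [hdnn a a']))
        (mul_nonneg hB₀ (sq_nonneg _))
  have h363 := ineq363_op_vPrime b T U blk d hη A kQ kF sQ sF c w ρu d₀ M₂ C a₀ δ₀ δ α β ρ Λ B₀ α₁ hB₀ hα₁ hΛ hρ hα hβ
    hδ₀ hδ hr hdnn htri hlen h261 hT1 hT2 hM₂ hrepr hsmall hA h337s hρu hd₀ hd₀0 hw hcard hC ha₀ hkQ hkF hsQ hsF hc h342_1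
    h342_2
  exact gpExt_entry1_of_363 (R := Rr) (H := H) (fun p : S × ι => blk p.1) d ρ α' _ B₀ (fun a => g.len a ^ 2) hB₀
    (fun a => sq_nonneg _) hθ0 hα'ρ htri hrefl hdnn h261' (h263_of_h261 (g := g) (R := Rr) (H := H) d ρ α' htri hρ hα'1 h261')
    hθ hGρ h363

end Existence

/-! ## §4  The bootstrap letter `V′(A)G′(U′U)` of the (3.68) chain, for the concrete `V′(A)` -/

section Bootstrap

variable {𝔸 : Type*} [NormedRing 𝔸] [NormedAlgebra ℂ 𝔸] [CompleteSpace 𝔸] {ι : Type} [Fintype ι] [DecidableEq ι]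
variable (b : Module.Basis ι ℝ 𝔸) {S : Type} [Fintype S] [DecidableEq S] {κ : Type} [Fintype κ]
variable (T : κ → Equiv.Perm S) (U : κ → S → 𝔸ˣ)
variable {g : B9.Geometry} [Fintype g.Site] [DecidableEq g.Site] {Rr : ℝ} {H : Prop}

/-- **`V′(A)G′(U′U)` HAS A (3.63)-TYPE MAJORANT, CONCRETE `V′(A)`** (the letter `hVE : V′E ≺ c_Vα₁B_Ee^{−δd}` of
`B9Ineq368PPrime.ineq368_op` / `B9Ineq368CommSum.ineq368_op_Ds_of_comm_sum`, a «(3.63)-type input» there; p. 403, after (3.68): «The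
remainder can be written explicitly in terms of the operators introduced until now by writing the expansions of the
operators determining P(U′U).»):
with `W = V′(A)G′(U) ≺ θe^{−ρd}` (§2, `θ = θ₃₆₃`) and `G′(U′U) = G′(U) + G′(U′U)W` (3.65)₂, the operator `T := V′(A)G′(U′U)`
satisfies `T = W + T·W`, hence by [4] (2.66) (`B6RandomWalk.majorant_of_fixedPoint_266` at `G₀ := W`, `P := 1`):
`V′(A)G′(U′U) ≺ θc₁(α′)(1 − θc₁(α′))⁻¹·e^{−(1−α′)ρd(y,y′)}` — the «additional small factor O(1)α₁» is `θ = O(1)B₀α₁`.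
[cite: Balaban1985BackgroundPropagators, (3.63)–(3.65) p.402 + p.403 l.1–9 + (3.68) p.403; Balaban1984PropagatorsII, (2.66) p.234 + Lemma 2.1 p.234] -/
theorem hasMajorant_vPrime_gpExt (blk : S → g.Site) (d : ℕ) {η : ℝ} (hη : 0 < η) (A : κ → S → 𝔸)
    (kQ kF : g.Site → S → 𝔸 →L[ℝ] 𝔸) (sQ sF : S → 𝔸 →L[ℝ] 𝔸) (c w : g.Site → ℝ) (ρu d₀ M₂ C a₀ : ℝ)
    (δ₀ δ α β ρ Λ B₀ α₁ α' : ℝ)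
    (hB₀ : 0 ≤ B₀) (hα₁ : 0 ≤ α₁) (hΛ : 0 ≤ Λ) (hρ : 0 ≤ ρ) (hα : 0 ≤ α) (hβ : 0 ≤ β) (hδ₀ : 0 ≤ δ₀) (hδ : 0 ≤ δ)
    (hr : ρ + (α + β) * δ₀ ≤ δ) (hα'ρ : 0 ≤ (1 - α') * ρ) (hα'1 : α' ≤ 1)
    (hdnn : ∀ a a' : g.Site, 0 ≤ g.dist a a') (hrefl : ∀ y : g.Site, g.dist y y = 0)
    (htri : Triangle254 (toB6 g Rr H)) (hlen : ∀ y : g.Site, 0 < g.len y)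
    (h261 : Ineq261 d (toB6 g Rr H) δ₀ β) (h261' : Ineq261 d (toB6 g Rr H) ρ α')
    (hT1 : ScaleTransfer g δ₀ α Λ (fun a => g.len a)) (hT2 : ScaleTransfer g δ₀ α Λ (fun a => g.len a ^ 2))
    (hM₂ : 0 ≤ M₂) (hrepr : ∀ (v : 𝔸) (i : ι), |b.repr v i| ≤ M₂ * ‖v‖)
    (hsmall : ∀ y : g.Site, η * (α₁ * (g.len y)⁻¹) ≤ 1 / 4)
    (hA : ∀ μ x, ‖A μ x‖ ≤ α₁ * (g.len (blk x))⁻¹ ∧ ‖tauB T U μ (A μ) x‖ ≤ α₁ * (g.len (blk x))⁻¹)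
    (h337s : ∀ μ x, ‖((η : ℂ)⁻¹) • covDstar T U μ (A μ) x‖ ≤ α₁ * (g.len (blk x) ^ 2)⁻¹)
    (hρu : ∀ μ x, ‖((U μ x : 𝔸ˣ) : 𝔸)‖ ≤ ρu ∧ ‖(((U μ x)⁻¹ : 𝔸ˣ) : 𝔸)‖ ≤ ρu)
    (hd₀ : ∀ μ x, g.dist (blk x) (blk (T μ x)) ≤ d₀ ∧ g.dist (blk x) (blk ((T μ).symm x)) ≤ d₀)
    (hd₀0 : ∀ y : g.Site, g.dist y y ≤ d₀)
    (hw : ∀ y, 0 ≤ w y) (hcard : ∀ y, ((B9Eq360Vprime.block blk y).card : ℝ) * w y ≤ 1) (hC : 0 ≤ C) (ha₀ : 0 ≤ a₀)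
    (hkQ : ∀ y x, blk x = y → ‖kQ y x‖ ≤ w y) (hkF : ∀ y x, blk x = y → ‖kF y x‖ ≤ C * α₁ * w y)
    (hsQ : ∀ x, ‖sQ x‖ ≤ 1) (hsF : ∀ x, ‖sF x‖ ≤ C * α₁) (hc : ∀ y, |c y| ≤ a₀ * (g.len y ^ 2)⁻¹)
    (hθ : theta363 (Fintype.card κ) ρu α₁ a₀ C M₂ (∑ i, ‖b i‖) (Real.exp (δ * d₀)) B₀ Λ (B6.c1 d δ₀ β) *
      B6.c1 d ρ α' < 1)
    {Gp : Module.End ℝ (S × ι → ℝ)}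
    (h342_1 : HasMajorant (g := toB6 g Rr H) (fun p : S × ι => blk p.1) Gp
      (fun a a' => B₀ * g.len a ^ 2 * Real.exp (-(δ * g.dist a a'))))
    (h342_2 : ∀ k : κ ⊕ κ, HasMajorant (g := toB6 g Rr H) (fun p : S × ι => blk p.1)
      (conj b (diffLetter T U ((η : ℂ)⁻¹) k) * Gp) (fun a a' => B₀ * g.len a * Real.exp (-(δ * g.dist a a')))) :
    HasMajorant (g := toB6 g Rr H) (fun p : S × ι => blk p.1)
      (conj b (vPrimeConc T U η A blk kQ kF sQ sF c)
        * gPrimeExtEnd Gp (conj b (vPrimeConc T U η A blk kQ kF sQ sF c) * Gp))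
      (fun a a' => theta363 (Fintype.card κ) ρu α₁ a₀ C M₂ (∑ i, ‖b i‖) (Real.exp (δ * d₀)) B₀ Λ (B6.c1 d δ₀ β)
          * B6.c1 d ρ α'
          * (1 - theta363 (Fintype.card κ) ρu α₁ a₀ C M₂ (∑ i, ‖b i‖) (Real.exp (δ * d₀)) B₀ Λ (B6.c1 d δ₀ β)
              * B6.c1 d ρ α')⁻¹
          * Real.exp (-((1 - α') * ρ * g.dist a a'))) := by
  set V : Module.End ℝ (S × ι → ℝ) := conj b (vPrimeConc T U η A blk kQ kF sQ sF c) with hVdef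
  set θ : ℝ := theta363 (Fintype.card κ) ρu α₁ a₀ C M₂ (∑ i, ‖b i‖) (Real.exp (δ * d₀)) B₀ Λ (B6.c1 d δ₀ β)
    with hθdef
  have hSb : 0 ≤ ∑ i, ‖b i‖ := Finset.sum_nonneg fun i _ => norm_nonneg _
  have hθ0 : 0 ≤ θ :=
    theta363_nonneg hα₁ ha₀ hC hM₂ hSb (Real.exp_nonneg _) hB₀ hΛ (B6RandomWalk.c1_nonneg d δ₀ β)
  have h363 : HasMajorant (g := toB6 g Rr H) (fun p : S × ι => blk p.1) (V * Gp)
      (fun a a' => θ * Real.exp (-(ρ * g.dist a a'))) :=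
    ineq363_op_vPrime b T U blk d hη A kQ kF sQ sF c w ρu d₀ M₂ C a₀ δ₀ δ α β ρ Λ B₀ α₁ hB₀ hα₁ hΛ hρ hα hβ hδ₀ hδ hr
      hdnn htri hlen h261 hT1 hT2 hM₂ hrepr hsmall hA h337s hρu hd₀ hd₀0 hw hcard hC ha₀ hkQ hkF hsQ hsF hc h342_1 h342_2
  have hW : ‖B9Eq360Vprime.toCLM (V * Gp)‖ < 1 :=
    opNorm_lt_one_of_363_261 (g := toB6 g Rr H) (fun p : S × ι => blk p.1) d ρ α' θ hθ0 hα'ρ hdnn h261' hθ h363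
  -- the fixed-point identity `T = W + T·W` for `T := V′·G′(U′U)`
  have h365 := eq365_end Gp (V * Gp) hW
  have hfix : V * gPrimeExtEnd Gp (V * Gp) = V * Gp + V * gPrimeExtEnd Gp (V * Gp) * (V * Gp) := by
    conv_lhs => rw [h365]
    noncomm_ring
  have hG0 : HasMajorant (g := toB6 g Rr H) (fun p : S × ι => blk p.1) (V * Gp)
      (fun a a' => θ * (1 : ℝ) * Real.exp (-(ρ * g.dist a a'))) :=
    hasMajorant_mono (g := toB6 g Rr H) _ h363 fun a a' => le_of_eq (by ring)
  have h := majorant_of_fixedPoint_266 (g := toB6 g Rr H) (fun p : S × ι => blk p.1) d ρ α' θ θ (fun _ => (1 : ℝ))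
    hθ0 (fun _ => zero_le_one) hθ0 hα'ρ htri hrefl hdnn h261'
    (h263_of_h261 (g := g) (R := Rr) (H := H) d ρ α' htri hρ hα'1 h261') hθ hG0 h363 hfix
  refine hasMajorant_mono (g := toB6 g Rr H) _ h fun a a' => le_of_eq ?_
  simp only [B9Thm34Ext.toB6_dist, mul_one]

end Bootstrap

/-! ## §5  (v1.1) The LEFT composite `G′(U)V′(A)`, the RIGHT entry (3.42)₃ and the left entries (3.42)₂,₄ of `G′(U′U)`,
for the concrete `V′(A)` — p. 403 «we can prove all the statements (3.42)–(3.47) of Theorem 3.1 for the operator G′(U′U)» -/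

section Entries

open Literature.MathematicalPhysics.QuantumFieldTheory.Balaban1983to89.B6RandomWalkHom (HasMajorantHom b9_leftEntry_of_365)
open Literature.MathematicalPhysics.QuantumFieldTheory.Balaban1983to89.B9Ineq386CommSum (hasMajorant_GV_of_gradForm_comm_sum)
open Literature.MathematicalPhysics.QuantumFieldTheory.Balaban1983to89.B9Ineq386RightEntry (gExt_rightEntry_of_386L)
open Literature.MathematicalPhysics.QuantumFieldTheory.Balaban1983to89.B9Eq360Vprime (eq365_end_left)
open Literature.MathematicalPhysics.QuantumFieldTheory.Balaban1983to89.B9Eq352GradLetters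
  (hasMajorant_comm_coefLetter_diffLetter)

variable {𝔸 : Type*} [NormedRing 𝔸] [NormedAlgebra ℂ 𝔸] [CompleteSpace 𝔸] {ι : Type} [Fintype ι]
variable (b : Module.Basis ι ℝ 𝔸) {S : Type} [Fintype S] {κ : Type} [Fintype κ]
variable (T : κ → Equiv.Perm S) (U : κ → S → 𝔸ˣ)
variable {g : B9.Geometry} [Fintype g.Site] [DecidableEq g.Site] {Rr : ℝ} {H : Prop}

/-- The «O(1)B₀α₁» of the LEFT composite `G′(U)V′(A)` for the concrete `V′(A)`: `θ_L = κ₃₈₅(B₀, cVConc + 2d·2ρu²M₂(Σ‖b‖)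
e^{δd₀}, 0, 0, Λ, c)·α₁` (the commutator constants `c_{K,k} = 2ρu²M₂(Σ‖b‖)e^{δd₀}` of `B9Eq352GradLetters` summed over
`κ ⊕ κ`). [cite: Balaban1985BackgroundPropagators, (3.63)–(3.65) p.402 + (3.37) p.396; Balaban1985RegularSpaces, (1.87) p.91] -/
def thetaL363 (d : ℕ) (ρu α₁ a₀ C M₂ Sb E₀ B₀ Λ c : ℝ) : ℝ :=
  kappa385 B₀ (cVConc d ρu α₁ a₀ C M₂ Sb E₀ + 2 * d * (2 * ρu ^ 2 * M₂ * Sb * E₀)) 0 0 Λ c * α₁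

/-- `θ_L ≧ 0`. [cite: Balaban1985BackgroundPropagators, (3.63) p.402] -/
theorem thetaL363_nonneg {d : ℕ} {ρu α₁ a₀ C M₂ Sb E₀ B₀ Λ c : ℝ} (hα₁ : 0 ≤ α₁) (ha₀ : 0 ≤ a₀) (hC : 0 ≤ C)
    (hM₂ : 0 ≤ M₂) (hSb : 0 ≤ Sb) (hE₀ : 0 ≤ E₀) (hB₀ : 0 ≤ B₀) (hΛ : 0 ≤ Λ) (hc : 0 ≤ c) :
    0 ≤ thetaL363 d ρu α₁ a₀ C M₂ Sb E₀ B₀ Λ c := by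
  have h1 := cVConc_nonneg (d := d) (ρu := ρu) hα₁ ha₀ hC hM₂ hSb hE₀
  have h2 : 0 ≤ cVConc d ρu α₁ a₀ C M₂ Sb E₀ + 2 * d * (2 * ρu ^ 2 * M₂ * Sb * E₀) := by positivity
  exact mul_nonneg (kappa385_nonneg hB₀ h2 le_rfl le_rfl hΛ hc) hα₁

/-- **THE LEFT COMPOSITE `G′(U)V′(A)` FOR THE CONCRETE `V′(A)`** (the all-left routing needed for the right entry of
`G′(U′U)`; NOT displayed in print — (3.63) is the right composite `V′G′` — and derived here from the DIVERGENCE FORM of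
the concrete `V′`: `G′V′ = Σ_k (G′∇_k)V¹_k + G′C″`, `C″ = (V⁰ − avgOp) + Σ_k[V¹_k,∇_k]` with the commutators of the lattice
Leibniz rule [B8] (1.87) of (3.37) size): `G′(U) * conj b V′(A) ≺ θ_L·e^{−ρd}`, from (3.42)₁ for `G′(U)` and its
RIGHT-derivative entries `G′(U)∇_k ≺ B₀Lʲη e^{−δd}` per concrete difference letter (p. 398 «we may always replace ∇_U by
∇*_U»), the inverse-weight scale transfers and Lemma 2.1 of [4].  (`B9Ineq386CommSum.hasMajorant_GV_of_gradForm_comm_sum`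
at `P₁ = P₂ = 0` with `hV0`/`hV1`/`hComm` DISCHARGED.)
[cite: Balaban1985BackgroundPropagators, (3.60)–(3.65) p.402 + (3.52)–(3.54) pp.400–401 + (3.37) p.396 + (3.42) p.397 + p.398 (remarks); Balaban1985RegularSpaces, (1.87) p.91; Balaban1984PropagatorsII, Lemma 2.1 p.234 + (2.52)–(2.55) p.232] -/
theorem hasMajorant_gp_vPrime (blk : S → g.Site) (d : ℕ) {η : ℝ} (hη : 0 < η) (A : κ → S → 𝔸)
    (kQ kF : g.Site → S → 𝔸 →L[ℝ] 𝔸) (sQ sF : S → 𝔸 →L[ℝ] 𝔸) (c w : g.Site → ℝ) (ρu d₀ M₂ C a₀ : ℝ)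
    (δ₀ δ α β ρ Λ B₀ α₁ : ℝ)
    (hB₀ : 0 ≤ B₀) (hα₁ : 0 ≤ α₁) (hΛ : 0 ≤ Λ) (hρ : 0 ≤ ρ) (hα : 0 ≤ α) (hβ : 0 ≤ β) (hδ₀ : 0 ≤ δ₀) (hδ : 0 ≤ δ)
    (hr : ρ + (α + β) * δ₀ ≤ δ)
    (hdnn : ∀ a a' : g.Site, 0 ≤ g.dist a a') (htri : Triangle254 (toB6 g Rr H)) (hlen : ∀ y : g.Site, 0 < g.len y)
    (h261 : Ineq261 d (toB6 g Rr H) δ₀ β)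
    (hT1i : ScaleTransfer g δ₀ α Λ (fun a => (g.len a)⁻¹)) (hT2i : ScaleTransfer g δ₀ α Λ (fun a => (g.len a ^ 2)⁻¹))
    (hM₂ : 0 ≤ M₂) (hrepr : ∀ (v : 𝔸) (i : ι), |b.repr v i| ≤ M₂ * ‖v‖)
    (hsmall : ∀ y : g.Site, η * (α₁ * (g.len y)⁻¹) ≤ 1 / 4)
    (hA : ∀ μ x, ‖A μ x‖ ≤ α₁ * (g.len (blk x))⁻¹ ∧ ‖tauB T U μ (A μ) x‖ ≤ α₁ * (g.len (blk x))⁻¹)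
    (h337s : ∀ μ x, ‖((η : ℂ)⁻¹) • covDstar T U μ (A μ) x‖ ≤ α₁ * (g.len (blk x) ^ 2)⁻¹)
    (h337F : ∀ μ x, ‖((η : ℂ)⁻¹) • covD T U μ (A μ) x‖ ≤ α₁ * (g.len (blk x) ^ 2)⁻¹)
    (h337B : ∀ μ x, ‖((η : ℂ)⁻¹) • covDstar T U μ (tauB T U μ (A μ)) x‖ ≤ α₁ * (g.len (blk x) ^ 2)⁻¹)
    (hρu : ∀ μ x, ‖((U μ x : 𝔸ˣ) : 𝔸)‖ ≤ ρu ∧ ‖(((U μ x)⁻¹ : 𝔸ˣ) : 𝔸)‖ ≤ ρu)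
    (hd₀ : ∀ μ x, g.dist (blk x) (blk (T μ x)) ≤ d₀ ∧ g.dist (blk x) (blk ((T μ).symm x)) ≤ d₀)
    (hd₀0 : ∀ y : g.Site, g.dist y y ≤ d₀)
    (hw : ∀ y, 0 ≤ w y) (hcard : ∀ y, ((B9Eq360Vprime.block blk y).card : ℝ) * w y ≤ 1) (hC : 0 ≤ C) (ha₀ : 0 ≤ a₀)
    (hkQ : ∀ y x, blk x = y → ‖kQ y x‖ ≤ w y) (hkF : ∀ y x, blk x = y → ‖kF y x‖ ≤ C * α₁ * w y)
    (hsQ : ∀ x, ‖sQ x‖ ≤ 1) (hsF : ∀ x, ‖sF x‖ ≤ C * α₁) (hc : ∀ y, |c y| ≤ a₀ * (g.len y ^ 2)⁻¹)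
    {Gp : Module.End ℝ (S × ι → ℝ)}
    (h342_1 : HasMajorant (g := toB6 g Rr H) (fun p : S × ι => blk p.1) Gp
      (fun a a' => B₀ * g.len a ^ 2 * Real.exp (-(δ * g.dist a a'))))
    (h342_3 : ∀ k : κ ⊕ κ, HasMajorant (g := toB6 g Rr H) (fun p : S × ι => blk p.1)
      (Gp * conj b (diffLetter T U ((η : ℂ)⁻¹) k)) (fun a a' => B₀ * g.len a * Real.exp (-(δ * g.dist a a')))) :
    HasMajorant (g := toB6 g Rr H) (fun p : S × ι => blk p.1)
      (Gp * conj b (vPrimeConc T U η A blk kQ kF sQ sF c))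
      (fun a a' => thetaL363 (Fintype.card κ) ρu α₁ a₀ C M₂ (∑ i, ‖b i‖) (Real.exp (δ * d₀)) B₀ Λ (B6.c1 d δ₀ β) *
        Real.exp (-(ρ * g.dist a a'))) := by
  have hSb : 0 ≤ ∑ i, ‖b i‖ := Finset.sum_nonneg fun i _ => norm_nonneg _
  have hE₀ : 0 ≤ Real.exp (δ * d₀) := Real.exp_nonneg _
  have hcC0 : 0 ≤ ((2 + 8 * ρu ^ 2 * α₁) * Fintype.card κ + a₀ * C * (2 + C * α₁)) * M₂ * (∑ i, ‖b i‖) *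
      Real.exp (δ * d₀) := by positivity
  have hcV : 0 ≤ cVConc (Fintype.card κ) ρu α₁ a₀ C M₂ (∑ i, ‖b i‖) (Real.exp (δ * d₀)) :=
    cVConc_nonneg hα₁ ha₀ hC hM₂ hSb hE₀
  have hV0 : HasMajorant (g := toB6 g Rr H) (fun p : S × ι => blk p.1)
      (conj b (V0op T U η A) - conj b (avgOp blk kQ kF sQ sF c))
      (fun y y' => cVConc (Fintype.card κ) ρu α₁ a₀ C M₂ (∑ i, ‖b i‖) (Real.exp (δ * d₀)) * α₁ * (g.len y ^ 2)⁻¹ *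
        Real.exp (-(δ * g.dist y y'))) := by
    refine hasMajorant_mono (g := toB6 g Rr H) _
      (hasMajorant_V0_vPrime b T U blk hη A kQ kF sQ sF c w ρu d₀ δ M₂ α₁ C a₀ hα₁ hδ hM₂ hrepr hlen hsmall hA h337s hρu
        hd₀ hd₀0 hw hcard hC ha₀ hkQ hkF hsQ hsF hc) fun y y' => ?_
    have hw2 : 0 ≤ (g.len y ^ 2)⁻¹ := inv_nonneg.mpr (sq_nonneg _)
    have hε : 0 ≤ Real.exp (-(δ * g.dist y y')) := Real.exp_nonneg _
    have hle : ((2 + 8 * ρu ^ 2 * α₁) * Fintype.card κ + a₀ * C * (2 + C * α₁)) * M₂ * (∑ i, ‖b i‖) *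
        Real.exp (δ * d₀) ≤ cVConc (Fintype.card κ) ρu α₁ a₀ C M₂ (∑ i, ‖b i‖) (Real.exp (δ * d₀)) := by
      have hcB : 0 ≤ cBConc (Fintype.card κ) M₂ (∑ i, ‖b i‖) (Real.exp (δ * d₀)) := by
        unfold cBConc; positivity
      unfold cVConc; linarith
    gcongr
  have hP : HasMajorant (g := toB6 g Rr H) (fun p : S × ι => blk p.1) (0 : Module.End ℝ (S × ι → ℝ))
      (fun a a' => 0 * α₁ * (g.len a ^ 2)⁻¹ * Real.exp (-(δ * g.dist a a'))) :=
    hasMajorant_mono (g := toB6 g Rr H) _ (hasMajorant_zero (g := toB6 g Rr H) _) fun a a' => le_of_eq (by ring)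
  have h := hasMajorant_GV_of_gradForm_comm_sum (R := Rr) (H := H) (fun p : S × ι => blk p.1) d
    (Finset.univ : Finset (κ ⊕ κ)) δ₀ δ α β ρ Λ B₀
    (cVConc (Fintype.card κ) ρu α₁ a₀ C M₂ (∑ i, ‖b i‖) (Real.exp (δ * d₀))) 0 0 α₁
    (fun _ => 2 * M₂ * (∑ i, ‖b i‖) * Real.exp (δ * d₀)) (fun _ => 2 * ρu ^ 2 * M₂ * (∑ i, ‖b i‖) * Real.exp (δ * d₀))
    hB₀ hcV le_rfl le_rfl hα₁ hΛ hρ hα hβ hδ₀ hr (fun _ _ => by positivity) ?_ (fun _ _ => by positivity) hdnn htri hlen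
    h261 hT1i hT2i (P₁ := 0) (P₂ := 0) (V1 := fun k => conj b (coefLetter T U A k))
    (D := fun k => conj b (diffLetter T U ((η : ℂ)⁻¹) k)) (conj_vPrimeConc_eq_gradForm b T U η A blk kQ kF sQ sF c)
    hV0 (fun k _ => hasMajorant_coefLetter b T U blk A d₀ δ M₂ α₁ hα₁ hδ hM₂ hrepr hlen hA hd₀0 k)
    (fun k _ => hasMajorant_comm_coefLetter_diffLetter b T U blk η A ρu d₀ δ M₂ α₁ hα₁ hδ hM₂ hrepr h337F h337B hρu
      hd₀ k)
    hP hP h342_1 (fun k _ => h342_3 k)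
  · have e : Gp * vTotal (conj b (vPrimeConc T U η A blk kQ kF sQ sF c)) (0 : Module.End ℝ (S × ι → ℝ)) 0
        = Gp * conj b (vPrimeConc T U η A blk kQ kF sQ sF c) := by simp [vTotal]
    rw [e] at h
    refine hasMajorant_mono (g := toB6 g Rr H) _ h fun a a' => le_of_eq ?_
    rw [Finset.sum_const, Finset.card_univ, Fintype.card_sum, nsmul_eq_mul, Nat.cast_add, thetaL363]
    ring
  · rw [Finset.sum_const, Finset.card_univ, Fintype.card_sum, nsmul_eq_mul, Nat.cast_add, cVConc, cBConc]
    nlinarith [hcC0]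

variable [DecidableEq ι] [DecidableEq S]

/-- **(3.42)₃ — THE RIGHT ENTRY `G′(U′U)∇*` — FOR THE CONCRETE `V′(A)`** (p. 403 «all the statements (3.42)–(3.47) of
Theorem 3.1 for the operator G′(U′U)», third sup-entry): for the operator `G′(U′U) := gPrimeExtEnd G′ (V′G′)` of (3.64) and
a right letter `D*` with Theorem 3.1's entry `G′(U)D* ≺ B₀Lʲη e^{−δd}`: `G′(U′U)D* ≺ B₀Λ_ρ²c₁(α′)(1 − θ_Lc₁(α′))⁻¹·Lʲη·
e^{−(1−3α′)ρd}` — from the FIRST form of (3.65) (`eq365_end_left`, available because `‖V′G′‖_{∞→∞} < 1` by (3.63) = §2),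
the left composite `hasMajorant_gp_vPrime`, the p. 398 convention at `(ρ, α′)` and [4] (2.66)
(`B9Ineq386RightEntry.gExt_rightEntry_of_386L`, whose algebra is (3.86) = (3.65)₁).  Smallness: `θ₃₆₃c₁(α′) < 1` (existence)
and `θ_Lc₁(α′) < 1` (this entry).
[cite: Balaban1985BackgroundPropagators, (3.42) p.397 + p.398 (remarks) + (3.62)–(3.65) pp.402–403 + Thm 3.4 p.400; Balaban1984PropagatorsII, (2.66) p.234 + Lemma 2.1 p.234] -/
theorem gpExt_rightEntry_vPrime (blk : S → g.Site) (d : ℕ) {η : ℝ} (hη : 0 < η) (A : κ → S → 𝔸)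
    (kQ kF : g.Site → S → 𝔸 →L[ℝ] 𝔸) (sQ sF : S → 𝔸 →L[ℝ] 𝔸) (c w : g.Site → ℝ) (ρu d₀ M₂ C a₀ : ℝ)
    (δ₀ δ α β ρ Λ Λρ B₀ α₁ α' : ℝ)
    (hB₀ : 0 ≤ B₀) (hα₁ : 0 ≤ α₁) (hΛ : 0 ≤ Λ) (hΛρ : 0 ≤ Λρ) (hρ : 0 ≤ ρ) (hα : 0 ≤ α) (hβ : 0 ≤ β) (hδ₀ : 0 ≤ δ₀)
    (hδ : 0 ≤ δ) (hr : ρ + (α + β) * δ₀ ≤ δ) (hα'1 : α' ≤ 1) (hα'ρ : 0 ≤ (1 - α') * ρ) (hα'ρ0 : 0 ≤ α' * ρ)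
    (hα'ρ2 : 0 ≤ (1 - 2 * α') * ρ)
    (hdnn : ∀ a a' : g.Site, 0 ≤ g.dist a a') (hrefl : ∀ y : g.Site, g.dist y y = 0)
    (hsym : ∀ y y' : g.Site, g.dist y y' = g.dist y' y)
    (htri : Triangle254 (toB6 g Rr H)) (hlen : ∀ y : g.Site, 0 < g.len y)
    (h261 : Ineq261 d (toB6 g Rr H) δ₀ β) (h261' : Ineq261 d (toB6 g Rr H) ρ α')
    (hT1 : ScaleTransfer g δ₀ α Λ (fun a => g.len a)) (hT2 : ScaleTransfer g δ₀ α Λ (fun a => g.len a ^ 2))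
    (hT1i : ScaleTransfer g δ₀ α Λ (fun a => (g.len a)⁻¹)) (hT2i : ScaleTransfer g δ₀ α Λ (fun a => (g.len a ^ 2)⁻¹))
    (hTρ : ScaleTransfer g ρ α' Λρ (fun a => g.len a))
    (hM₂ : 0 ≤ M₂) (hrepr : ∀ (v : 𝔸) (i : ι), |b.repr v i| ≤ M₂ * ‖v‖)
    (hsmall : ∀ y : g.Site, η * (α₁ * (g.len y)⁻¹) ≤ 1 / 4)
    (hA : ∀ μ x, ‖A μ x‖ ≤ α₁ * (g.len (blk x))⁻¹ ∧ ‖tauB T U μ (A μ) x‖ ≤ α₁ * (g.len (blk x))⁻¹)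
    (h337s : ∀ μ x, ‖((η : ℂ)⁻¹) • covDstar T U μ (A μ) x‖ ≤ α₁ * (g.len (blk x) ^ 2)⁻¹)
    (h337F : ∀ μ x, ‖((η : ℂ)⁻¹) • covD T U μ (A μ) x‖ ≤ α₁ * (g.len (blk x) ^ 2)⁻¹)
    (h337B : ∀ μ x, ‖((η : ℂ)⁻¹) • covDstar T U μ (tauB T U μ (A μ)) x‖ ≤ α₁ * (g.len (blk x) ^ 2)⁻¹)
    (hρu : ∀ μ x, ‖((U μ x : 𝔸ˣ) : 𝔸)‖ ≤ ρu ∧ ‖(((U μ x)⁻¹ : 𝔸ˣ) : 𝔸)‖ ≤ ρu)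
    (hd₀ : ∀ μ x, g.dist (blk x) (blk (T μ x)) ≤ d₀ ∧ g.dist (blk x) (blk ((T μ).symm x)) ≤ d₀)
    (hd₀0 : ∀ y : g.Site, g.dist y y ≤ d₀)
    (hw : ∀ y, 0 ≤ w y) (hcard : ∀ y, ((B9Eq360Vprime.block blk y).card : ℝ) * w y ≤ 1) (hC : 0 ≤ C) (ha₀ : 0 ≤ a₀)
    (hkQ : ∀ y x, blk x = y → ‖kQ y x‖ ≤ w y) (hkF : ∀ y x, blk x = y → ‖kF y x‖ ≤ C * α₁ * w y)
    (hsQ : ∀ x, ‖sQ x‖ ≤ 1) (hsF : ∀ x, ‖sF x‖ ≤ C * α₁) (hc : ∀ y, |c y| ≤ a₀ * (g.len y ^ 2)⁻¹)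
    (hθ : theta363 (Fintype.card κ) ρu α₁ a₀ C M₂ (∑ i, ‖b i‖) (Real.exp (δ * d₀)) B₀ Λ (B6.c1 d δ₀ β) *
      B6.c1 d ρ α' < 1)
    (hθL : thetaL363 (Fintype.card κ) ρu α₁ a₀ C M₂ (∑ i, ‖b i‖) (Real.exp (δ * d₀)) B₀ Λ (B6.c1 d δ₀ β) *
      B6.c1 d ρ α' < 1)
    {Gp Ds : Module.End ℝ (S × ι → ℝ)}
    (h342_1 : HasMajorant (g := toB6 g Rr H) (fun p : S × ι => blk p.1) Gp
      (fun a a' => B₀ * g.len a ^ 2 * Real.exp (-(δ * g.dist a a'))))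
    (h342_2 : ∀ k : κ ⊕ κ, HasMajorant (g := toB6 g Rr H) (fun p : S × ι => blk p.1)
      (conj b (diffLetter T U ((η : ℂ)⁻¹) k) * Gp) (fun a a' => B₀ * g.len a * Real.exp (-(δ * g.dist a a'))))
    (h342_3 : ∀ k : κ ⊕ κ, HasMajorant (g := toB6 g Rr H) (fun p : S × ι => blk p.1)
      (Gp * conj b (diffLetter T U ((η : ℂ)⁻¹) k)) (fun a a' => B₀ * g.len a * Real.exp (-(δ * g.dist a a'))))
    (h342R : HasMajorant (g := toB6 g Rr H) (fun p : S × ι => blk p.1) (Gp * Ds)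
      (fun a a' => B₀ * g.len a * Real.exp (-(δ * g.dist a a')))) :
    HasMajorant (g := toB6 g Rr H) (fun p : S × ι => blk p.1)
      (gPrimeExtEnd Gp (conj b (vPrimeConc T U η A blk kQ kF sQ sF c) * Gp) * Ds)
      (fun a a' => B₀ * Λρ ^ 2 * B6.c1 d ρ α'
          * (1 - thetaL363 (Fintype.card κ) ρu α₁ a₀ C M₂ (∑ i, ‖b i‖) (Real.exp (δ * d₀)) B₀ Λ (B6.c1 d δ₀ β)
              * B6.c1 d ρ α')⁻¹
          * g.len a * Real.exp (-((1 - 3 * α') * ρ * g.dist a a'))) := by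
  set V : Module.End ℝ (S × ι → ℝ) := conj b (vPrimeConc T U η A blk kQ kF sQ sF c) with hVdef
  have hSb : 0 ≤ ∑ i, ‖b i‖ := Finset.sum_nonneg fun i _ => norm_nonneg _
  have hθ0 : 0 ≤ theta363 (Fintype.card κ) ρu α₁ a₀ C M₂ (∑ i, ‖b i‖) (Real.exp (δ * d₀)) B₀ Λ (B6.c1 d δ₀ β) :=
    theta363_nonneg hα₁ ha₀ hC hM₂ hSb (Real.exp_nonneg _) hB₀ hΛ (B6RandomWalk.c1_nonneg d δ₀ β)
  have hθL0 : 0 ≤ thetaL363 (Fintype.card κ) ρu α₁ a₀ C M₂ (∑ i, ‖b i‖) (Real.exp (δ * d₀)) B₀ Λ (B6.c1 d δ₀ β) :=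
    thetaL363_nonneg hα₁ ha₀ hC hM₂ hSb (Real.exp_nonneg _) hB₀ hΛ (B6RandomWalk.c1_nonneg d δ₀ β)
  have hρδ : ρ ≤ δ := by
    have : 0 ≤ (α + β) * δ₀ := by positivity
    linarith
  -- (3.63) for the concrete V′ gives the sup-operator norm < 1, hence the FIRST form of (3.65) for `gPrimeExtEnd`
  have h363 : HasMajorant (g := toB6 g Rr H) (fun p : S × ι => blk p.1) (V * Gp)
      (fun a a' => theta363 (Fintype.card κ) ρu α₁ a₀ C M₂ (∑ i, ‖b i‖) (Real.exp (δ * d₀)) B₀ Λ (B6.c1 d δ₀ β) *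
        Real.exp (-(ρ * g.dist a a'))) :=
    ineq363_op_vPrime b T U blk d hη A kQ kF sQ sF c w ρu d₀ M₂ C a₀ δ₀ δ α β ρ Λ B₀ α₁ hB₀ hα₁ hΛ hρ hα hβ hδ₀ hδ hr
      hdnn htri hlen h261 hT1 hT2 hM₂ hrepr hsmall hA h337s hρu hd₀ hd₀0 hw hcard hC ha₀ hkQ hkF hsQ hsF hc h342_1 h342_2
  have hW : ‖B9Eq360Vprime.toCLM (V * Gp)‖ < 1 :=
    opNorm_lt_one_of_363_261 (g := toB6 g Rr H) (fun p : S × ι => blk p.1) d ρ α' _ hθ0 hα'ρ hdnn h261' hθ h363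
  have h386L : gPrimeExtEnd Gp (V * Gp) = Gp + Gp * V * gPrimeExtEnd Gp (V * Gp) := eq365_end_left Gp V hW
  -- the left composite and the (3.42)₃ input at the rate ρ
  have hGV := hasMajorant_gp_vPrime b T U blk d hη A kQ kF sQ sF c w ρu d₀ M₂ C a₀ δ₀ δ α β ρ Λ B₀ α₁ hB₀ hα₁ hΛ hρ hα
    hβ hδ₀ hδ hr hdnn htri hlen h261 hT1i hT2i hM₂ hrepr hsmall hA h337s h337F h337B hρu hd₀ hd₀0 hw hcard hC ha₀ hkQ hkF
    hsQ hsF hc h342_1 h342_3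
  have h342R' : HasMajorant (g := toB6 g Rr H) (fun p : S × ι => blk p.1) (Gp * Ds)
      (fun a a' => B₀ * g.len a * Real.exp (-(ρ * g.dist a a'))) :=
    hasMajorant_mono (g := toB6 g Rr H) _ h342R fun a a' =>
      mul_le_mul_of_nonneg_left (Real.exp_le_exp.mpr (by nlinarith [hdnn a a'])) (mul_nonneg hB₀ (hlen a).le)
  exact gExt_rightEntry_of_386L (R := Rr) (H := H) (fun p : S × ι => blk p.1) d ρ α' _ B₀ Λρ (fun a => g.len a) hB₀
    hΛρ (fun a => (hlen a).le) hθL0 hρ hα'1 hα'ρ0 hα'ρ2 htri hrefl hsym hdnn h261' hθL hTρ h342R' hGV h386L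

/-- **(3.42)₂,₄-TYPE LEFT ENTRIES `E·G′(U′U)` FOR THE CONCRETE `V′(A)`** (p. 403, the left sup-entries; `E = ∇_U` with weight
`P = Lʲη`, `E = 1` with `P = (Lʲη)²`, …, any two-space left letter `E : (S × ι → ℝ) →ₗ (Y → ℝ)`): from Theorem 3.1's entry
`E·G′(U) ≺ B₀P(y)e^{−δd}`, the (3.63)-majorant of `V′G′` for the concrete `V′` (§2) and the SECOND form of (3.65):
`E·G′(U′U) ≺ B₀c₁(α′)(1 − θ₃₆₃c₁(α′))⁻¹·P(y)·e^{−(1−α′)ρd}` (pv21's `B6RandomWalkHom.b9_leftEntry_of_365` with `h363`, `h365`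
DISCHARGED). [cite: Balaban1985BackgroundPropagators, (3.42) p.397 + (3.62)–(3.65) pp.402–403 + Thm 3.4 p.400; Balaban1984PropagatorsII, (2.66) p.234] -/
theorem gpExt_leftEntry_vPrime {Y : Type} [Fintype Y] [DecidableEq Y] (blk : S → g.Site) (blkY : Y → g.Site) (d : ℕ)
    {η : ℝ} (hη : 0 < η) (A : κ → S → 𝔸)
    (kQ kF : g.Site → S → 𝔸 →L[ℝ] 𝔸) (sQ sF : S → 𝔸 →L[ℝ] 𝔸) (c w : g.Site → ℝ) (ρu d₀ M₂ C a₀ : ℝ)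
    (δ₀ δ α β ρ Λ B₀ α₁ α' : ℝ) (P : g.Site → ℝ)
    (hB₀ : 0 ≤ B₀) (hP : ∀ y, 0 ≤ P y) (hα₁ : 0 ≤ α₁) (hΛ : 0 ≤ Λ) (hρ : 0 ≤ ρ) (hα : 0 ≤ α) (hβ : 0 ≤ β)
    (hδ₀ : 0 ≤ δ₀) (hδ : 0 ≤ δ) (hr : ρ + (α + β) * δ₀ ≤ δ) (hα'ρ : 0 ≤ (1 - α') * ρ) (hα'1 : α' ≤ 1)
    (hdnn : ∀ a a' : g.Site, 0 ≤ g.dist a a') (hrefl : ∀ y : g.Site, g.dist y y = 0)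
    (htri : Triangle254 (toB6 g Rr H)) (hlen : ∀ y : g.Site, 0 < g.len y)
    (h261 : Ineq261 d (toB6 g Rr H) δ₀ β) (h261' : Ineq261 d (toB6 g Rr H) ρ α')
    (hT1 : ScaleTransfer g δ₀ α Λ (fun a => g.len a)) (hT2 : ScaleTransfer g δ₀ α Λ (fun a => g.len a ^ 2))
    (hM₂ : 0 ≤ M₂) (hrepr : ∀ (v : 𝔸) (i : ι), |b.repr v i| ≤ M₂ * ‖v‖)
    (hsmall : ∀ y : g.Site, η * (α₁ * (g.len y)⁻¹) ≤ 1 / 4)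
    (hA : ∀ μ x, ‖A μ x‖ ≤ α₁ * (g.len (blk x))⁻¹ ∧ ‖tauB T U μ (A μ) x‖ ≤ α₁ * (g.len (blk x))⁻¹)
    (h337s : ∀ μ x, ‖((η : ℂ)⁻¹) • covDstar T U μ (A μ) x‖ ≤ α₁ * (g.len (blk x) ^ 2)⁻¹)
    (hρu : ∀ μ x, ‖((U μ x : 𝔸ˣ) : 𝔸)‖ ≤ ρu ∧ ‖(((U μ x)⁻¹ : 𝔸ˣ) : 𝔸)‖ ≤ ρu)
    (hd₀ : ∀ μ x, g.dist (blk x) (blk (T μ x)) ≤ d₀ ∧ g.dist (blk x) (blk ((T μ).symm x)) ≤ d₀)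
    (hd₀0 : ∀ y : g.Site, g.dist y y ≤ d₀)
    (hw : ∀ y, 0 ≤ w y) (hcard : ∀ y, ((B9Eq360Vprime.block blk y).card : ℝ) * w y ≤ 1) (hC : 0 ≤ C) (ha₀ : 0 ≤ a₀)
    (hkQ : ∀ y x, blk x = y → ‖kQ y x‖ ≤ w y) (hkF : ∀ y x, blk x = y → ‖kF y x‖ ≤ C * α₁ * w y)
    (hsQ : ∀ x, ‖sQ x‖ ≤ 1) (hsF : ∀ x, ‖sF x‖ ≤ C * α₁) (hc : ∀ y, |c y| ≤ a₀ * (g.len y ^ 2)⁻¹)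
    (hθ : theta363 (Fintype.card κ) ρu α₁ a₀ C M₂ (∑ i, ‖b i‖) (Real.exp (δ * d₀)) B₀ Λ (B6.c1 d δ₀ β) *
      B6.c1 d ρ α' < 1)
    {Gp : Module.End ℝ (S × ι → ℝ)} {E : (S × ι → ℝ) →ₗ[ℝ] (Y → ℝ)}
    (h342_1 : HasMajorant (g := toB6 g Rr H) (fun p : S × ι => blk p.1) Gp
      (fun a a' => B₀ * g.len a ^ 2 * Real.exp (-(δ * g.dist a a'))))
    (h342_2 : ∀ k : κ ⊕ κ, HasMajorant (g := toB6 g Rr H) (fun p : S × ι => blk p.1)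
      (conj b (diffLetter T U ((η : ℂ)⁻¹) k) * Gp) (fun a a' => B₀ * g.len a * Real.exp (-(δ * g.dist a a'))))
    (h342E : HasMajorantHom (g := toB6 g Rr H) (fun p : S × ι => blk p.1) blkY (E ∘ₗ Gp)
      (fun a a' => B₀ * P a * Real.exp (-(ρ * g.dist a a')))) :
    HasMajorantHom (g := toB6 g Rr H) (fun p : S × ι => blk p.1) blkY
      (E ∘ₗ gPrimeExtEnd Gp (conj b (vPrimeConc T U η A blk kQ kF sQ sF c) * Gp))
      (fun a a' => B₀ * B6.c1 d ρ α'
          * (1 - theta363 (Fintype.card κ) ρu α₁ a₀ C M₂ (∑ i, ‖b i‖) (Real.exp (δ * d₀)) B₀ Λ (B6.c1 d δ₀ β)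
              * B6.c1 d ρ α')⁻¹
          * P a * Real.exp (-((1 - α') * ρ * g.dist a a'))) := by
  set V : Module.End ℝ (S × ι → ℝ) := conj b (vPrimeConc T U η A blk kQ kF sQ sF c) with hVdef
  have hSb : 0 ≤ ∑ i, ‖b i‖ := Finset.sum_nonneg fun i _ => norm_nonneg _
  have hθ0 : 0 ≤ theta363 (Fintype.card κ) ρu α₁ a₀ C M₂ (∑ i, ‖b i‖) (Real.exp (δ * d₀)) B₀ Λ (B6.c1 d δ₀ β) :=
    theta363_nonneg hα₁ ha₀ hC hM₂ hSb (Real.exp_nonneg _) hB₀ hΛ (B6RandomWalk.c1_nonneg d δ₀ β)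
  have h363 : HasMajorant (g := toB6 g Rr H) (fun p : S × ι => blk p.1) (V * Gp)
      (fun a a' => theta363 (Fintype.card κ) ρu α₁ a₀ C M₂ (∑ i, ‖b i‖) (Real.exp (δ * d₀)) B₀ Λ (B6.c1 d δ₀ β) *
        Real.exp (-(ρ * g.dist a a'))) :=
    ineq363_op_vPrime b T U blk d hη A kQ kF sQ sF c w ρu d₀ M₂ C a₀ δ₀ δ α β ρ Λ B₀ α₁ hB₀ hα₁ hΛ hρ hα hβ hδ₀ hδ hr
      hdnn htri hlen h261 hT1 hT2 hM₂ hrepr hsmall hA h337s hρu hd₀ hd₀0 hw hcard hC ha₀ hkQ hkF hsQ hsF hc h342_1 h342_2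
  have hW : ‖B9Eq360Vprime.toCLM (V * Gp)‖ < 1 :=
    opNorm_lt_one_of_363_261 (g := toB6 g Rr H) (fun p : S × ι => blk p.1) d ρ α' _ hθ0 hα'ρ hdnn h261' hθ h363
  have h365 := eq365_end Gp (V * Gp) hW
  exact b9_leftEntry_of_365 (R := Rr) (H := H) (fun p : S × ι => blk p.1) blkY d ρ α' _ B₀ P hB₀ hP hθ0 hα'ρ htri
    hrefl hdnn h261' (h263_of_h261 (g := g) (R := Rr) (H := H) d ρ α' htri hρ hα'1 h261') hθ h342E h363 h365

/-- **THEOREM 3.4, `G′`-PART, FOR THE CONCRETE `V′(A)` — existence + (3.42)₁ + (3.42)₃ for one and the same `G′(U′U)`**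
(p. 400 Theorem 3.4: «G′(U) … extend to configurations U′U for α₁ ≦ a₁ … The extended operators satisfy all the inequalities of
Theorems 3.1–3.3 correspondingly», the `G′` clause, sup-entries 1 and 3): with `V′ = conj b (vPrimeConc …)` and `G′(U′U) :=
gPrimeExtEnd G′(U) (V′G′(U))` — the Neumann series (3.64) on the finite lattice — and `G′(U)` the two-sided inverse of `Δ′ =
Δ_U + Q′*(U)aQ′(U)`: `(Δ′ − V′)G′(U′U) = 1 = G′(U′U)(Δ′ − V′)`, `G′(U′U) ≺ B₀c₁(1 − θ₃₆₃c₁)⁻¹(Lʲη)²e^{−(1−α′)ρd}` and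
`G′(U′U)D* ≺ B₀Λ_ρ²c₁(1 − θ_Lc₁)⁻¹Lʲη e^{−(1−3α′)ρd}`, under the two smallness conditions `θ₃₆₃c₁(α′) < 1`, `θ_Lc₁(α′) < 1`
(«for α₁ sufficiently small»; both θ's are `O(1)B₀α₁` with the O(1) explicit).  Inputs: Theorem 3.1 for `G′(U)` (entries
`G′`, `∇_kG′`, `G′∇_k` per concrete difference letter, `G′D*`), (3.37) blockwise, transports, stencil geometry, the
(3.19)/(3.58)/(3.24) kernel bounds, Lemma 2.1 of [4] and the p. 398 convention.
[cite: Balaban1985BackgroundPropagators, Thm 3.4 p.400 + (3.62)–(3.65) pp.402–403 + (3.42) p.397 + p.398 (remarks); Balaban1984PropagatorsII, (2.66) p.234 + Lemma 2.1 p.234] -/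
theorem thm34_Gp_entries13_vPrime (blk : S → g.Site) (d : ℕ) {η : ℝ} (hη : 0 < η) (A : κ → S → 𝔸)
    (kQ kF : g.Site → S → 𝔸 →L[ℝ] 𝔸) (sQ sF : S → 𝔸 →L[ℝ] 𝔸) (c w : g.Site → ℝ) (ρu d₀ M₂ C a₀ : ℝ)
    (δ₀ δ α β ρ Λ Λρ B₀ α₁ α' : ℝ)
    (hB₀ : 0 ≤ B₀) (hα₁ : 0 ≤ α₁) (hΛ : 0 ≤ Λ) (hΛρ : 0 ≤ Λρ) (hρ : 0 ≤ ρ) (hα : 0 ≤ α) (hβ : 0 ≤ β) (hδ₀ : 0 ≤ δ₀)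
    (hδ : 0 ≤ δ) (hr : ρ + (α + β) * δ₀ ≤ δ) (hα'1 : α' ≤ 1) (hα'ρ : 0 ≤ (1 - α') * ρ) (hα'ρ0 : 0 ≤ α' * ρ)
    (hα'ρ2 : 0 ≤ (1 - 2 * α') * ρ)
    (hdnn : ∀ a a' : g.Site, 0 ≤ g.dist a a') (hrefl : ∀ y : g.Site, g.dist y y = 0)
    (hsym : ∀ y y' : g.Site, g.dist y y' = g.dist y' y)
    (htri : Triangle254 (toB6 g Rr H)) (hlen : ∀ y : g.Site, 0 < g.len y)
    (h261 : Ineq261 d (toB6 g Rr H) δ₀ β) (h261' : Ineq261 d (toB6 g Rr H) ρ α')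
    (hT1 : ScaleTransfer g δ₀ α Λ (fun a => g.len a)) (hT2 : ScaleTransfer g δ₀ α Λ (fun a => g.len a ^ 2))
    (hT1i : ScaleTransfer g δ₀ α Λ (fun a => (g.len a)⁻¹)) (hT2i : ScaleTransfer g δ₀ α Λ (fun a => (g.len a ^ 2)⁻¹))
    (hTρ : ScaleTransfer g ρ α' Λρ (fun a => g.len a))
    (hM₂ : 0 ≤ M₂) (hrepr : ∀ (v : 𝔸) (i : ι), |b.repr v i| ≤ M₂ * ‖v‖)
    (hsmall : ∀ y : g.Site, η * (α₁ * (g.len y)⁻¹) ≤ 1 / 4)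
    (hA : ∀ μ x, ‖A μ x‖ ≤ α₁ * (g.len (blk x))⁻¹ ∧ ‖tauB T U μ (A μ) x‖ ≤ α₁ * (g.len (blk x))⁻¹)
    (h337s : ∀ μ x, ‖((η : ℂ)⁻¹) • covDstar T U μ (A μ) x‖ ≤ α₁ * (g.len (blk x) ^ 2)⁻¹)
    (h337F : ∀ μ x, ‖((η : ℂ)⁻¹) • covD T U μ (A μ) x‖ ≤ α₁ * (g.len (blk x) ^ 2)⁻¹)
    (h337B : ∀ μ x, ‖((η : ℂ)⁻¹) • covDstar T U μ (tauB T U μ (A μ)) x‖ ≤ α₁ * (g.len (blk x) ^ 2)⁻¹)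
    (hρu : ∀ μ x, ‖((U μ x : 𝔸ˣ) : 𝔸)‖ ≤ ρu ∧ ‖(((U μ x)⁻¹ : 𝔸ˣ) : 𝔸)‖ ≤ ρu)
    (hd₀ : ∀ μ x, g.dist (blk x) (blk (T μ x)) ≤ d₀ ∧ g.dist (blk x) (blk ((T μ).symm x)) ≤ d₀)
    (hd₀0 : ∀ y : g.Site, g.dist y y ≤ d₀)
    (hw : ∀ y, 0 ≤ w y) (hcard : ∀ y, ((B9Eq360Vprime.block blk y).card : ℝ) * w y ≤ 1) (hC : 0 ≤ C) (ha₀ : 0 ≤ a₀)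
    (hkQ : ∀ y x, blk x = y → ‖kQ y x‖ ≤ w y) (hkF : ∀ y x, blk x = y → ‖kF y x‖ ≤ C * α₁ * w y)
    (hsQ : ∀ x, ‖sQ x‖ ≤ 1) (hsF : ∀ x, ‖sF x‖ ≤ C * α₁) (hc : ∀ y, |c y| ≤ a₀ * (g.len y ^ 2)⁻¹)
    (hθ : theta363 (Fintype.card κ) ρu α₁ a₀ C M₂ (∑ i, ‖b i‖) (Real.exp (δ * d₀)) B₀ Λ (B6.c1 d δ₀ β) *
      B6.c1 d ρ α' < 1)
    (hθL : thetaL363 (Fintype.card κ) ρu α₁ a₀ C M₂ (∑ i, ‖b i‖) (Real.exp (δ * d₀)) B₀ Λ (B6.c1 d δ₀ β) *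
      B6.c1 d ρ α' < 1)
    (Δp Gp : Module.End ℝ (S × ι → ℝ)) (hΔG : Δp * Gp = 1) (hGΔ : Gp * Δp = 1) {Ds : Module.End ℝ (S × ι → ℝ)}
    (h342_1 : HasMajorant (g := toB6 g Rr H) (fun p : S × ι => blk p.1) Gp
      (fun a a' => B₀ * g.len a ^ 2 * Real.exp (-(δ * g.dist a a'))))
    (h342_2 : ∀ k : κ ⊕ κ, HasMajorant (g := toB6 g Rr H) (fun p : S × ι => blk p.1)
      (conj b (diffLetter T U ((η : ℂ)⁻¹) k) * Gp) (fun a a' => B₀ * g.len a * Real.exp (-(δ * g.dist a a'))))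
    (h342_3 : ∀ k : κ ⊕ κ, HasMajorant (g := toB6 g Rr H) (fun p : S × ι => blk p.1)
      (Gp * conj b (diffLetter T U ((η : ℂ)⁻¹) k)) (fun a a' => B₀ * g.len a * Real.exp (-(δ * g.dist a a'))))
    (h342R : HasMajorant (g := toB6 g Rr H) (fun p : S × ι => blk p.1) (Gp * Ds)
      (fun a a' => B₀ * g.len a * Real.exp (-(δ * g.dist a a')))) :
    let V := conj b (vPrimeConc T U η A blk kQ kF sQ sF c)
    let GpExt := gPrimeExtEnd Gp (V * Gp)
    (Δp - V) * GpExt = 1 ∧ GpExt * (Δp - V) = 1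
      ∧ HasMajorant (g := toB6 g Rr H) (fun p : S × ι => blk p.1) GpExt
          (fun a a' => B₀ * B6.c1 d ρ α'
            * (1 - theta363 (Fintype.card κ) ρu α₁ a₀ C M₂ (∑ i, ‖b i‖) (Real.exp (δ * d₀)) B₀ Λ (B6.c1 d δ₀ β)
                * B6.c1 d ρ α')⁻¹
            * g.len a ^ 2 * Real.exp (-((1 - α') * ρ * g.dist a a')))
      ∧ HasMajorant (g := toB6 g Rr H) (fun p : S × ι => blk p.1) (GpExt * Ds)
          (fun a a' => B₀ * Λρ ^ 2 * B6.c1 d ρ α'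
            * (1 - thetaL363 (Fintype.card κ) ρu α₁ a₀ C M₂ (∑ i, ‖b i‖) (Real.exp (δ * d₀)) B₀ Λ (B6.c1 d δ₀ β)
                * B6.c1 d ρ α')⁻¹
            * g.len a * Real.exp (-((1 - 3 * α') * ρ * g.dist a a'))) := by
  intro V GpExt
  have hSb : 0 ≤ ∑ i, ‖b i‖ := Finset.sum_nonneg fun i _ => norm_nonneg _
  have hθ0 : 0 ≤ theta363 (Fintype.card κ) ρu α₁ a₀ C M₂ (∑ i, ‖b i‖) (Real.exp (δ * d₀)) B₀ Λ (B6.c1 d δ₀ β) :=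
    theta363_nonneg hα₁ ha₀ hC hM₂ hSb (Real.exp_nonneg _) hB₀ hΛ (B6RandomWalk.c1_nonneg d δ₀ β)
  have h363 : HasMajorant (g := toB6 g Rr H) (fun p : S × ι => blk p.1) (V * Gp)
      (fun a a' => theta363 (Fintype.card κ) ρu α₁ a₀ C M₂ (∑ i, ‖b i‖) (Real.exp (δ * d₀)) B₀ Λ (B6.c1 d δ₀ β) *
        Real.exp (-(ρ * g.dist a a'))) :=
    ineq363_op_vPrime b T U blk d hη A kQ kF sQ sF c w ρu d₀ M₂ C a₀ δ₀ δ α β ρ Λ B₀ α₁ hB₀ hα₁ hΛ hρ hα hβ hδ₀ hδ hr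
      hdnn htri hlen h261 hT1 hT2 hM₂ hrepr hsmall hA h337s hρu hd₀ hd₀0 hw hcard hC ha₀ hkQ hkF hsQ hsF hc h342_1 h342_2
  have hW : ‖B9Eq360Vprime.toCLM (V * Gp)‖ < 1 :=
    opNorm_lt_one_of_363_261 (g := toB6 g Rr H) (fun p : S × ι => blk p.1) d ρ α' _ hθ0 hα'ρ hdnn h261' hθ h363
  refine ⟨B9Eq360Vprime.deltaSub_mul_gPrimeExtEnd Δp V Gp hΔG hW, B9Eq360Vprime.gPrimeExtEnd_mul_deltaSub Δp V Gp hGΔ hW,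
    ?_, ?_⟩
  · exact gpExt_entry1_vPrime b T U blk d hη A kQ kF sQ sF c w ρu d₀ M₂ C a₀ δ₀ δ α β ρ Λ B₀ α₁ α' hB₀ hα₁ hΛ hρ hα hβ hδ₀
      hδ hr hα'ρ hα'1 hdnn hrefl htri hlen h261 h261' hT1 hT2 hM₂ hrepr hsmall hA h337s hρu hd₀ hd₀0 hw hcard hC ha₀ hkQ hkF
      hsQ hsF hc hθ h342_1 h342_2
  · exact gpExt_rightEntry_vPrime b T U blk d hη A kQ kF sQ sF c w ρu d₀ M₂ C a₀ δ₀ δ α β ρ Λ Λρ B₀ α₁ α' hB₀ hα₁ hΛ hΛρ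
      hρ hα hβ hδ₀ hδ hr hα'1 hα'ρ hα'ρ0 hα'ρ2 hdnn hrefl hsym htri hlen h261 h261' hT1 hT2 hT1i hT2i hTρ hM₂ hrepr hsmall
      hA h337s h337F h337B hρu hd₀ hd₀0 hw hcard hC ha₀ hkQ hkF hsQ hsF hc hθ hθL h342_1 h342_2 h342_3 h342R

end Entries

end Literature.MathematicalPhysics.QuantumFieldTheory.Balaban1983to89.B9Ineq363Vprime
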